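import Literature.NumberTheory.ConnesConsani2021.QuasiInnerPrimeOffDiag
import Literature.NumberTheory.ConnesConsani2021.QuasiInnerArchDiscResidues
import Literature.Analysis.Complex.RectangleCauchyDerivatives
import HarnessLib

/-!
# Connes–Consani 2021 (JNT) §4.3 — the residues of `ρ_∞ρ_p` behind Theorem 4.4 (ii) (bricks)

LINE 1 — LABEL: RH-FREE corpus literature (function theory of the product `ρ_∞ρ_p` of two ratios of
local factors on and to the left of the critical line: poles, residues, a contour identity); bears_on:
W-C/W-P (P5 sequel vocabulary, no leaf role); WHAT THIS IS NOT: any claim about RH — nothing in this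
file bears on the truth of RH.

Source: A. Connes, C. Consani, *Quasi-inner functions and local factors*, J. Number Theory **226**
(2021) 139–167 = arXiv:2008.10974 [bib: `ConnesConsani2021QuasiInner`], proof of Theorem 4.4 (ii),
arXiv chunks p0011:L100–p0012:L18: «We compute the Fourier coefficients of the function
`κ_{p,∞}(v) := (ρ_∞ρ_p)(½ + (v+1)/(v−1))` … as the sum of residues on the set `𝓡` of poles … To justify
this step we use the same contour as in Section 2 and the same choice `R = (2m+1)π/log p` as in the
proof of Lemma 3.5 … The poles are of three kinds. We have the non-zero poles of `ρ_∞`, the non-zero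
poles of `ρ_p`, and the double pole at `z = 0`. The residues are, for the simple poles, multiplied by the
value of the other factor at the point … The contribution of the double pole at `z = 0` gives an operator
of finite rank.»

THEOREMS ONLY (no definition, no named fact); vocabulary = `QuasiInnerLocalFactors.lean` (`rhoArch`,
`rhoPrime`, `cayleyInv`, `xPrime`), the kernel `R_j(z) = ψ⁻¹(z)^j·(−8)/(2z−3)²` of
`QuasiInnerPrimeResidues.lean`, the pole data of `QuasiInnerArchResidues.lean` (seat t17).

## Content (RH-FREE) — bricks for the discharge of the named fact `thm_4_4_ii` (row t18)

* `exists_pole_structure_rhoPrime_zero` — `ρ_p = ψ(z)/z` near `0`, `ψ(0) = (1 − 1/p)/log p`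
  (the `j`-free form of the pole of `ρ_p` at `0`).
* `exists_pole_structure_product_primePole` — at `z_n = 2πin/log p`, `n ≠ 0`:
  `ρ_∞ρ_pR_j = φ/(z − z_n)`, `φ(z_n) = ρ_∞(z_n)·((1 − 1/p)/log p)·R_j(z_n)` («one multiplies the residue
  by `ρ_∞(2πin/log p)`»).
* `exists_pole_structure_product_archPole` — at `−2n`, `n ≥ 1`: `ρ_∞ρ_pR_j = φ/(z + 2n)`,
  `φ(−2n) = r_n·ρ_p(−2n)R_j(−2n)`, `r_n = (−1)^n 2√π π^{2n}/(n!Γ(n+½))` («this multiplies the residue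
  by `ρ_p(−2n) = (1 − p^{−(2n+1)})/(1 − p^{2n})`»).
* `exists_doublePole_structure_product_zero` — at `0` (DOUBLE pole): there are `B₀ ∈ ℂ` and, for every
  `j`, a function `φ_j` differentiable near `0` with
  `ρ_∞ρ_pR_j − A_j z^{−2} = φ_j/z`, `A_j = (2(1 − 1/p)/log p)·R_j(0)`, `φ_j(0) = B₀R_j(0) + (2(1−1/p)/log p)·R_j′(0)`
  — ONE `j`-independent constant `B₀` (the printed «`α x^{k−1} + (k−1)β x^{k−1}`» shape that makes the
  contribution `ℰ₀` an operator of finite rank).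
* `exists_rectBoundaryIntegral_rhoArch_rhoPrime_kernel` — the residue formula on the printed rectangles
  `[½ − 2m, ½] × [−(2m+1)π/log p, (2m+1)π/log p]`, `m ≥ 1`: the boundary integral of `ρ_∞ρ_pR_j` equals
  `2πi (Σ_{1≤n≤m−1} r_nρ_p(−2n)R_j(−2n) + Σ_{0<|n|≤m} ρ_∞(2πin/log p)·8(1−1/p)log p(4πn+3i log p)⁻²x_p(n)^j
  + (B₀R_j(0) + (2(1−1/p)/log p)R_j′(0)))`.
* `exists_fourierCoeff_kappaArch_mul_kappaPrime_neg` — letting `m → ∞` (`|ρ_∞| ≤ C` on the three far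
  sides by seat t16's `exists_norm_rhoArch_le`, `|ρ_p| ≤ 1` on `Im z = ±(2m+1)π/log p`, Lemma 3.1 (iii)
  on the left side, `|ρ_∞ρ_p| = 1` on the critical line, seat t17's change of variables
  `fourierCoeff_circleRestrict_neg_eq_integral`): with the SAME `B₀`, for every `j` the residue families
  `α_n = r_nρ_p(−2n)R_j(−2n)` (`n ≥ 1`) and `β_n = ρ_∞(2πin/log p)·8(1−1/p)log p(4πn+3i log p)^{−2}x_p(n)^j`
  (`n ≠ 0`, `β_0 := 0`) are summable and
  `(κκ_p)^(−(j+1)) = Σ_{n≥0} α_{n+1} + Σ_{n∈ℤ} β_n + (B₀R_j(0) + (2(1−1/p)/log p)R_j′(0))` — the printed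
  `a^{(p,∞)}_{−k} = Σ_𝓡 Res(…)` with the three kinds of poles separated (the analytic input of
  `ℰ_∞`, `ℰ_p`, `ℰ_0`; the operator assembly is row t18's named fact `thm_4_4_ii`).

Nothing in this file bears on the truth of RH.
-/

noncomputable section

open _root_.MeasureTheory _root_.Complex Filter Set
open scoped Real Topology Nat

namespace Literature.NumberTheory.ConnesConsani2021

namespace QuasiInner

/-! ### Differentiability away from the poles -/

/-- The denominator `1 − p^{−z}` of `ρ_p`: derivative `p^{−z} log p`. [folklore] -/
private theorem pr_hasDerivAt_den {p : ℕ} (hp : 1 < p) (z : ℂ) :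
    HasDerivAt (fun w : ℂ => 1 - (p : ℂ) ^ (-w)) ((p : ℂ) ^ (-z) * Real.log p) z := by
  have hp0 : (p : ℂ) ≠ 0 := Nat.cast_ne_zero.2 (by omega)
  have h : HasDerivAt (fun w : ℂ => (p : ℂ) ^ (-w)) ((p : ℂ) ^ (-z) * Complex.log p * (-1)) z :=
    (hasDerivAt_neg z).const_cpow (Or.inl hp0)
  have h2 := (hasDerivAt_const z (1 : ℂ)).sub h
  rw [← Complex.natCast_log] at h2
  have e : (0 : ℂ) - (p : ℂ) ^ (-z) * (Real.log p : ℂ) * (-1) = (p : ℂ) ^ (-z) * Real.log p := by ring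
  rw [e] at h2
  exact h2

/-- The numerator `1 − p^{z−1}` of `ρ_p` is entire. [folklore] -/
private theorem pr_differentiable_num {p : ℕ} (hp : 1 < p) :
    Differentiable ℂ (fun w : ℂ => 1 - (p : ℂ) ^ (w - 1)) := by
  have hp0 : (p : ℂ) ≠ 0 := Nat.cast_ne_zero.2 (by omega)
  exact (differentiable_const _).sub ((differentiable_id.sub_const (1 : ℂ)).const_cpow (Or.inl hp0))

/-- `ρ_p` is complex differentiable off the imaginary axis (its poles are `(2πi/log p)ℤ`).
[cite: ConnesConsani2021QuasiInner, Lemma 3.1 (ii) (arXiv chunk p0008:L11)] -/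
theorem differentiableAt_rhoPrime {p : ℕ} (hp : 1 < p) {z : ℂ} (hz : z.re ≠ 0) :
    DifferentiableAt ℂ (rhoPrime p) z := by
  have hD : (1 : ℂ) - (p : ℂ) ^ (-z) ≠ 0 := by
    intro h
    obtain ⟨k, hk⟩ := (natCast_cpow_neg_eq_one_iff hp z).1 (sub_eq_zero.1 h).symm
    apply hz
    rw [hk, Complex.div_ofReal_re]
    simp
  have e : rhoPrime p = fun w => (1 - (p : ℂ) ^ (w - 1)) / (1 - (p : ℂ) ^ (-w)) := rfl
  rw [e]
  exact (pr_differentiable_num hp z).div (pr_hasDerivAt_den hp z).differentiableAt hD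

/-- `ρ_p` is complex differentiable wherever its denominator `1 − p^{−z}` does not vanish.
[cite: ConnesConsani2021QuasiInner, Lemma 3.1 (ii) (arXiv chunk p0008:L11)] -/
theorem differentiableAt_rhoPrime_of_ne {p : ℕ} (hp : 1 < p) {z : ℂ}
    (hD : (1 : ℂ) - (p : ℂ) ^ (-z) ≠ 0) : DifferentiableAt ℂ (rhoPrime p) z := by
  have e : rhoPrime p = fun w => (1 - (p : ℂ) ^ (w - 1)) / (1 - (p : ℂ) ^ (-w)) := rfl
  rw [e]
  exact (pr_differentiable_num hp z).div (pr_hasDerivAt_den hp z).differentiableAt hD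

/-- The kernel `R_j(z) = ψ⁻¹(z)^j·(ψ⁻¹)′(z) = ψ⁻¹(z)^j·(−8)/(2z−3)²` («implementing the differential
`dψ⁻¹(z) = −8(2z−3)⁻²dz`») is complex differentiable off `z = 3/2`.
[cite: ConnesConsani2021QuasiInner, §2 (arXiv chunk p0005:L38–L44)] -/
theorem differentiableAt_cayleyKernel {z : ℂ} (hz : (2 * z - 3 : ℂ) ≠ 0) (j : ℕ) :
    DifferentiableAt ℂ (fun w : ℂ => cayleyInv w ^ j * ((-8 : ℂ) / (2 * w - 3) ^ 2)) z := by
  have h1 : DifferentiableAt ℂ (fun w : ℂ => 2 * w - 3) z := by fun_prop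
  have h2 : DifferentiableAt ℂ (fun w : ℂ => 2 * w + 1) z := by fun_prop
  have hc : DifferentiableAt ℂ cayleyInv z := by
    have : cayleyInv = fun w : ℂ => (2 * w + 1) / (2 * w - 3) := rfl
    rw [this]
    exact h2.div h1 hz
  exact (hc.pow j).mul ((differentiableAt_const _).div (h1.pow 2) (pow_ne_zero 2 hz))

/-- `ρ_∞ = Γ_ℝ(z)/Γ_ℝ(1−z)` is complex differentiable off the real axis («the only singularities of
`ρ_∞ = Γ_ℝ(z)/Γ_ℝ(1−z)` in `ℂ₋` correspond to the poles of `Γ_ℝ(z) = π^{−z/2}Γ(z/2)` … at `−2ℕ`»).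
[cite: ConnesConsani2021QuasiInner, §2 (arXiv chunk p0005:L88–L92)] -/
theorem differentiableAt_rhoArch_of_im_ne_zero {z : ℂ} (hz : z.im ≠ 0) :
    DifferentiableAt ℂ rhoArch z := by
  refine differentiableAt_rhoArch fun h => ?_
  obtain ⟨n, hn⟩ := Complex.Gammaℝ_eq_zero_iff.1 h
  apply hz
  rw [hn]
  simp

/-- `ρ_∞` is complex differentiable at every `z` whose real part is not an even non-positive integer
(the poles of `Γ_ℝ(z)` are `−2ℕ`). [cite: ConnesConsani2021QuasiInner, §2 (arXiv chunk p0005:L88–L92)] -/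
theorem differentiableAt_rhoArch_of_re {z : ℂ} (hz : ∀ n : ℕ, z.re ≠ -(2 * (n : ℝ))) :
    DifferentiableAt ℂ rhoArch z := by
  refine differentiableAt_rhoArch fun h => ?_
  obtain ⟨n, hn⟩ := Complex.Gammaℝ_eq_zero_iff.1 h
  apply hz n
  rw [hn]
  simp

/-! ### The pole of `ρ_p` at `0` (the `j`-free form) -/

/-- **`ρ_p = ψ(z)/z` near `0` with `ψ(0) = (1 − 1/p)/log p`** (the expansion
«`ρ_p(z) = ((1 − 1/p)/log p)·z⁻¹ + (p−3)/2p + …`» in the concrete form used by the residue theorem;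
`ψ = (1 − p^{z−1})/dslope(1 − p^{−z}, 0)`).
[cite: ConnesConsani2021QuasiInner, Lemma 3.1, proof (arXiv chunk p0008:L13–L17)] -/
theorem exists_pole_structure_rhoPrime_zero {p : ℕ} (hp : 1 < p) :
    ∃ ψ : ℂ → ℂ, ∃ V ∈ 𝓝 (0 : ℂ), IsOpen V ∧ DifferentiableOn ℂ ψ V ∧
      ψ 0 = (1 - (p : ℂ)⁻¹) / Real.log p ∧
      ∀ z ∈ V, z ≠ 0 → rhoPrime p z = ψ z / z := by
  have hp0 : (p : ℂ) ≠ 0 := Nat.cast_ne_zero.2 (by omega)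
  have hlogR : 0 < Real.log p := Real.log_pos (by exact_mod_cast hp)
  have hL0 : (Real.log p : ℂ) ≠ 0 := ofReal_ne_zero.2 hlogR.ne'
  set D : ℂ → ℂ := fun w => 1 - (p : ℂ) ^ (-w) with hDdef
  set N : ℂ → ℂ := fun w => 1 - (p : ℂ) ^ (w - 1) with hNdef
  have hD0 : D 0 = 0 := by simp [hDdef]
  have hD' : deriv D 0 = Real.log p := by
    rw [(pr_hasDerivAt_den hp 0).deriv, neg_zero, cpow_zero, one_mul]
  have hDdiff : Differentiable ℂ D := fun z => (pr_hasDerivAt_den hp z).differentiableAt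
  have hDan : AnalyticAt ℂ D 0 := hDdiff.analyticAt 0
  obtain ⟨q, hq⟩ := hDan
  have hds_an : AnalyticAt ℂ (dslope D 0) 0 := (hq.has_fpower_series_dslope_fslope).analyticAt
  have hds_0 : dslope D 0 0 ≠ 0 := by rw [dslope_same, hD']; exact hL0
  have hev1 : ∀ᶠ z in 𝓝 (0 : ℂ), dslope D 0 z ≠ 0 := hds_an.continuousAt.eventually_ne hds_0
  have hev2 : ∀ᶠ z in 𝓝 (0 : ℂ), AnalyticAt ℂ (dslope D 0) z := hds_an.eventually_analyticAt
  obtain ⟨V, hVsub, hVo, hV0⟩ := mem_nhds_iff.1 (hev1.and hev2)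
  refine ⟨fun z => N z / dslope D 0 z, V, hVo.mem_nhds hV0, hVo, ?_, ?_, ?_⟩
  · intro z hz
    obtain ⟨hz1, hz2⟩ := hVsub hz
    exact ((pr_differentiable_num hp z).div hz2.differentiableAt hz1).differentiableWithinAt
  · simp only
    rw [dslope_same, hD']
    simp only [hNdef]
    rw [zero_sub, cpow_neg_one]
  · intro z hz hz0
    obtain ⟨hz1, -⟩ := hVsub hz
    have hfac : D z = z * dslope D 0 z := by
      have := sub_smul_dslope D 0 z
      rw [smul_eq_mul, hD0, sub_zero, sub_zero] at this
      exact this.symm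
    have hrho : rhoPrime p z = N z / D z := rfl
    rw [hrho, hfac]
    field_simp

/-! ### The simple poles of `ρ_∞ρ_pR_j` -/

/-- **At `z_n = 2πin/log p`, `n ≠ 0`**: `ρ_∞ρ_pR_j = φ/(z − z_n)` near `z_n` with
`φ(z_n) = ρ_∞(z_n)·((1 − 1/p)/log p)·R_j(z_n)` («One multiplies the residue by `ρ_∞(2πin/log p)`»).
[cite: ConnesConsani2021QuasiInner, Thm 4.4 proof (arXiv chunk p0012:L1–L4)] -/
theorem exists_pole_structure_product_primePole {p : ℕ} (hp : 1 < p) (j : ℕ) {n : ℤ} (hn : n ≠ 0) :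
    ∃ g : ℂ → ℂ, ∃ V ∈ 𝓝 (2 * π * I * n / Real.log p : ℂ), DifferentiableOn ℂ g V ∧
      g (2 * π * I * n / Real.log p) =
        rhoArch (2 * π * I * n / Real.log p) * ((1 - (p : ℂ)⁻¹) / Real.log p *
          (cayleyInv (2 * π * I * n / Real.log p) ^ j *
            ((-8 : ℂ) / (2 * (2 * π * I * n / Real.log p) - 3) ^ 2))) ∧
      ∀ z ∈ V, z ≠ 2 * π * I * n / Real.log p →
        rhoArch z * (rhoPrime p z * (cayleyInv z ^ j * ((-8 : ℂ) / (2 * z - 3) ^ 2))) =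
          g z / (z - 2 * π * I * n / Real.log p) := by
  have hlogR : 0 < Real.log p := Real.log_pos (by exact_mod_cast hp)
  obtain ⟨φ₀, V₀, hV₀, hd₀, hφ₀, hF₀⟩ := exists_pole_structure_rhoPrime_kernel hp j n
  have him : (2 * π * I * n / Real.log p : ℂ).im ≠ 0 := by
    rw [Complex.div_ofReal_im]
    simp only [mul_im, mul_re, re_ofNat, ofReal_re, im_ofNat, ofReal_im, mul_zero, sub_zero, I_re,
      I_im, zero_mul, add_zero, mul_one, intCast_re, intCast_im, zero_add]
    have : (2 * π * (n : ℝ)) / Real.log p ≠ 0 := by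
      refine div_ne_zero (mul_ne_zero (by positivity) ?_) hlogR.ne'
      exact_mod_cast hn
    convert this using 2
  have hopen : IsOpen {z : ℂ | z.im ≠ 0} := isOpen_ne_fun Complex.continuous_im continuous_const
  refine ⟨fun z => rhoArch z * φ₀ z, V₀ ∩ {z : ℂ | z.im ≠ 0}, inter_mem hV₀ (hopen.mem_nhds him),
    ?_, ?_, ?_⟩
  · intro z hz
    exact ((differentiableAt_rhoArch_of_im_ne_zero hz.2).differentiableWithinAt).mul
      ((hd₀ z hz.1).mono inter_subset_left)
  · simp only
    rw [hφ₀]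
  · intro z hz hzn
    rw [mul_div_assoc, ← hF₀ z hz.1 hzn]

/-- **At `−2n`, `n ≥ 1`**: `ρ_∞ρ_pR_j = φ/(z + 2n)` near `−2n` with `φ(−2n) = r_n·ρ_p(−2n)R_j(−2n)`,
`r_n = (−1)^n 2√π π^{2n}/(n!Γ(n+½))` the residue of `ρ_∞` («this multiplies the residue by
`ρ_p(−2n)`»). [cite: ConnesConsani2021QuasiInner, Thm 4.4 proof (arXiv chunk p0012:L1–L3)] -/
theorem exists_pole_structure_product_archPole {p : ℕ} (hp : 1 < p) (j : ℕ) {n : ℕ} (hn : 1 ≤ n) :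
    ∃ g : ℂ → ℂ, ∃ V ∈ 𝓝 (-(2 * (n : ℂ))), DifferentiableOn ℂ g V ∧
      g (-(2 * (n : ℂ))) =
        ((((-1 : ℝ) ^ n * 2 * (Real.sqrt π * π ^ (2 * n)) / (n ! * Real.Gamma (n + 1 / 2)) : ℝ)) : ℂ) *
          (rhoPrime p (-(2 * (n : ℂ))) *
            (cayleyInv (-(2 * (n : ℂ))) ^ j * ((-8 : ℂ) / (2 * (-(2 * (n : ℂ))) - 3) ^ 2))) ∧
      ∀ z ∈ V, z ≠ -(2 * (n : ℂ)) →
        rhoArch z * (rhoPrime p z * (cayleyInv z ^ j * ((-8 : ℂ) / (2 * z - 3) ^ 2))) =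
          g z / (z - -(2 * (n : ℂ))) := by
  obtain ⟨Φ, hΦd, hΦv, hΦF⟩ := exists_rhoArch_eq_div_sub_pole n
  have hn1 : (1 : ℝ) ≤ n := by exact_mod_cast hn
  refine ⟨fun z => Φ z * (rhoPrime p z * (cayleyInv z ^ j * ((-8 : ℂ) / (2 * z - 3) ^ 2))),
    Metric.ball (-(2 * (n : ℂ))) 1, Metric.isOpen_ball.mem_nhds (Metric.mem_ball_self one_pos),
    ?_, ?_, ?_⟩
  · intro z hz
    have hre : z.re < -(2 * n) + 1 := by
      have h1 := Metric.mem_ball.1 hz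
      rw [dist_eq_norm] at h1
      have h2 := Complex.abs_re_le_norm (z - -(2 * (n : ℂ)))
      have h3 : (z - -(2 * (n : ℂ))).re = z.re + 2 * n := by simp
      rw [h3] at h2
      have := (abs_le.1 (h2.trans h1.le)).2
      linarith [(abs_lt.1 (lt_of_le_of_lt h2 h1)).2]
    have hz0 : z.re ≠ 0 := by linarith
    have h23 : (2 * z - 3 : ℂ) ≠ 0 := by
      intro h
      have := congrArg Complex.re h
      simp at this
      linarith
    exact ((hΦd z hz).mul (((differentiableAt_rhoPrime hp hz0).mul
      (differentiableAt_cayleyKernel h23 j)).differentiableWithinAt))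
  · simp only
    rw [hΦv]
  · intro z hz hzn
    rw [hΦF z hz hzn]
    ring

/-! ### The double pole at `0` -/

/-- **The double pole at `z = 0`** («The expansion at `z = 0` gives a double pole … and a simple pole
with residue …; the dependence in `k` is of the form `αx^{k−1} + (k−1)βx^{k−1}`»), in the form used by
the residue theorem: there is ONE constant `B₀` (independent of `j`) such that, for every `j`,
`ρ_∞ρ_pR_j − A_j/z² = g_j(z)/z` near `0` with `A_j = (2(1 − 1/p)/log p)·R_j(0)` and
`g_j(0) = B₀R_j(0) + (2(1 − 1/p)/log p)·R_j′(0)` (`ρ_∞ = Φ/z`, `Φ(0) = 2`; `ρ_p = ψ/z`,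
`ψ(0) = (1 − 1/p)/log p`; `B₀ = (Φψ)′(0)`).
[cite: ConnesConsani2021QuasiInner, Thm 4.4 proof (arXiv chunk p0012:L5–L18)] -/
theorem exists_doublePole_structure_product_zero {p : ℕ} (hp : 1 < p) :
    ∃ B₀ : ℂ, ∀ j : ℕ, ∃ g : ℂ → ℂ, ∃ V ∈ 𝓝 (0 : ℂ), DifferentiableOn ℂ g V ∧
      g 0 = B₀ * (cayleyInv 0 ^ j * ((-8 : ℂ) / (2 * 0 - 3) ^ 2)) +
        2 * ((1 - (p : ℂ)⁻¹) / Real.log p) *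
          deriv (fun z : ℂ => cayleyInv z ^ j * ((-8 : ℂ) / (2 * z - 3) ^ 2)) 0 ∧
      ∀ z ∈ V, z ≠ 0 →
        rhoArch z * (rhoPrime p z * (cayleyInv z ^ j * ((-8 : ℂ) / (2 * z - 3) ^ 2))) -
            2 * ((1 - (p : ℂ)⁻¹) / Real.log p) * (cayleyInv 0 ^ j * ((-8 : ℂ) / (2 * 0 - 3) ^ 2)) /
              z ^ 2 = g z / z := by
  -- `ρ_∞ = Φ/z` near `0`, `Φ(0) = 2`
  obtain ⟨Φ, hΦd, hΦv, hΦF⟩ := exists_rhoArch_eq_div_sub_pole 0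
  have hc0 : (-(2 * ((0 : ℕ) : ℂ)) : ℂ) = 0 := by simp
  rw [hc0] at hΦd hΦv hΦF
  have hΦ0 : Φ 0 = 2 := by
    rw [hΦv, show Real.Gamma (((0 : ℕ) : ℝ) + 1 / 2) = Real.sqrt π by
      rw [Nat.cast_zero, zero_add, Real.Gamma_one_half_eq]]
    have hπ : (Real.sqrt π : ℂ) ≠ 0 := ofReal_ne_zero.2 (Real.sqrt_pos.2 Real.pi_pos).ne'
    push_cast
    simp only [pow_zero, Nat.factorial_zero, Nat.cast_one, one_mul, mul_one]
    field_simp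
  -- `ρ_p = ψ/z` near `0`, `ψ(0) = (1 − 1/p)/log p`
  obtain ⟨ψ, Vψ, hVψ, hVψo, hψd, hψ0, hψF⟩ := exists_pole_structure_rhoPrime_zero hp
  -- the constant
  refine ⟨deriv (fun z : ℂ => Φ z * ψ z) 0, fun j => ?_⟩
  set K : ℂ → ℂ := fun z : ℂ => cayleyInv z ^ j * ((-8 : ℂ) / (2 * z - 3) ^ 2) with hK
  set W : Set ℂ := Metric.ball (0 : ℂ) 1 ∩ Vψ with hW
  have hWo : IsOpen W := Metric.isOpen_ball.inter hVψo
  have hW0 : (0 : ℂ) ∈ W := ⟨Metric.mem_ball_self one_pos, mem_of_mem_nhds hVψ⟩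
  have hWn : W ∈ 𝓝 (0 : ℂ) := hWo.mem_nhds hW0
  have hKd : ∀ z ∈ W, DifferentiableAt ℂ K z := by
    intro z hz
    have h1 := Metric.mem_ball.1 hz.1
    rw [dist_zero_right] at h1
    have hre : z.re < 3 / 2 := by linarith [Complex.abs_re_le_norm z, (abs_lt.1 (lt_of_le_of_lt (Complex.abs_re_le_norm z) h1)).2]
    have h23 : (2 * z - 3 : ℂ) ≠ 0 := by
      intro h
      have := congrArg Complex.re h
      simp at this
      linarith
    exact differentiableAt_cayleyKernel h23 j
  set h : ℂ → ℂ := fun z => Φ z * ψ z * K z with hh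
  have hΦψd : ∀ z ∈ W, DifferentiableAt ℂ (fun z => Φ z * ψ z) z := fun z hz =>
    ((hΦd z hz.1).differentiableAt (Metric.isOpen_ball.mem_nhds hz.1)).mul
      ((hψd z hz.2).differentiableAt (hVψo.mem_nhds hz.2))
  have hhd : DifferentiableOn ℂ h W := fun z hz =>
    ((hΦψd z hz).mul (hKd z hz)).differentiableWithinAt
  have hh0 : h 0 = 2 * ((1 - (p : ℂ)⁻¹) / Real.log p) * K 0 := by
    simp only [hh]
    rw [hΦ0, hψ0]
  refine ⟨dslope h 0, W, hWn, (Complex.differentiableOn_dslope hWn).2 hhd, ?_, ?_⟩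
  · -- the residue `h′(0) = (Φψ)′(0)·K(0) + (Φψ)(0)·K′(0)`
    rw [dslope_same]
    have e : h = fun z => (fun z => Φ z * ψ z) z * K z := by funext z; simp only [hh]
    rw [e, deriv_fun_mul (hΦψd 0 hW0) (hKd 0 hW0), hΦ0, hψ0]
  · intro z hz hz0
    have hfac : h z - h 0 = z * dslope h 0 z := by
      have := sub_smul_dslope h 0 z
      rw [smul_eq_mul, sub_zero] at this
      exact this.symm
    rw [hΦF z hz.1 hz0, hψF z hz.2 hz0, sub_zero, ← hh0]
    have : Φ z / z * (ψ z / z * (cayleyInv z ^ j * ((-8 : ℂ) / (2 * z - 3) ^ 2))) = h z / z ^ 2 := by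
      simp only [hh, hK]
      field_simp
    rw [this, ← sub_div, hfac]
    field_simp

/-- Subtracting the double-pole correction `A/z²` does not change a simple-pole structure away from
`0`. [folklore] -/
private theorem pole_structure_sub_correction {F g : ℂ → ℂ} {q A : ℂ} {V : Set ℂ} (hq : q ≠ 0)
    (hV : V ∈ 𝓝 q) (hg : DifferentiableOn ℂ g V) (hF : ∀ z ∈ V, z ≠ q → F z = g z / (z - q)) :
    ∃ g' : ℂ → ℂ, ∃ V' ∈ 𝓝 q, DifferentiableOn ℂ g' V' ∧ g' q = g q ∧
      ∀ z ∈ V', z ≠ q → F z - A / z ^ 2 = g' z / (z - q) := by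
  have hopen : IsOpen {z : ℂ | z ≠ 0} := isOpen_ne
  refine ⟨fun z => g z - A * (z - q) / z ^ 2, V ∩ {z : ℂ | z ≠ 0}, inter_mem hV (hopen.mem_nhds hq),
    ?_, by simp, ?_⟩
  · intro z hz
    have hz0 : (z : ℂ) ≠ 0 := hz.2
    refine ((hg z hz.1).mono inter_subset_left).sub ?_
    exact (((differentiableAt_const A).mul (differentiableAt_id.sub_const q)).div
      (differentiableAt_id.pow 2) (pow_ne_zero 2 hz0)).differentiableWithinAt
  · intro z hz hzq
    have hz0 : (z : ℂ) ≠ 0 := hz.2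
    have hzq' : (z - q : ℂ) ≠ 0 := sub_ne_zero.2 hzq
    rw [hF z hz.1 hzq]
    field_simp

/-! ### The residue formula on the printed rectangles -/

/-- Real and imaginary part of the pole `z_n = 2πin/log p`. [folklore] -/
private theorem pr_pole_re_im (p : ℕ) (n : ℤ) :
    (2 * π * I * n / Real.log p : ℂ).re = 0 ∧
      (2 * π * I * n / Real.log p : ℂ).im = 2 * π * n / Real.log p := by
  constructor
  · rw [Complex.div_ofReal_re]; simp
  · rw [Complex.div_ofReal_im]; simp

/-- **The residue formula for `ρ_∞ρ_pR_j` on the rectangle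
`[½ − 2m, ½] × [−(2m+1)π/log p, (2m+1)π/log p]`** (`m ≥ 1`; «the same contour as in Section 2 and the
same choice `R = (2m+1)π/log p` … The poles are of three kinds»): the boundary integral equals `2πi`
times the sum of the residues at the enclosed poles — `−2n` (`1 ≤ n ≤ m−1`, residue
`r_nρ_p(−2n)R_j(−2n)`), `2πin/log p` (`0 < |n| ≤ m`, residue `ρ_∞(2πin/log p)·8(1−1/p)log p
(4πn+3i log p)^{−2}x_p(n)^j`) and the double pole `0` (residue `B₀R_j(0) + (2(1−1/p)/log p)R_j′(0)`,
ONE constant `B₀` for all `j` and `m`). Residue theorem = the tree's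
`Literature.Analysis.Complex.rectBoundaryIntegral_eq_sum_of_simplePoles` applied to
`ρ_∞ρ_pR_j − A_j z^{−2}` (`∮ z^{−2} = 0`, `rectBoundaryIntegral_sub_zpow_eq_zero`).
[cite: ConnesConsani2021QuasiInner, Thm 4.4 (ii) proof (arXiv chunk p0011:L100–p0012:L18)] -/
theorem exists_rectBoundaryIntegral_rhoArch_rhoPrime_kernel {p : ℕ} (hp : p.Prime) :
    ∃ B₀ : ℂ, ∀ (j : ℕ) (m : ℕ), 1 ≤ m →
      Literature.Analysis.Complex.rectBoundaryIntegral
          (fun z : ℂ => rhoArch z * (rhoPrime p z * (cayleyInv z ^ j * ((-8 : ℂ) / (2 * z - 3) ^ 2))))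
          (1 / 2 - 2 * m) (1 / 2) (-((2 * m + 1) * π / Real.log p)) ((2 * m + 1) * π / Real.log p) =
        2 * π * I *
          ((∑ n ∈ Finset.Icc 1 (m - 1),
              ((((-1 : ℝ) ^ n * 2 * (Real.sqrt π * π ^ (2 * n)) / (n ! * Real.Gamma (n + 1 / 2)) : ℝ)) : ℂ) *
                (rhoPrime p (-(2 * (n : ℂ))) *
                  (cayleyInv (-(2 * (n : ℂ))) ^ j * ((-8 : ℂ) / (2 * (-(2 * (n : ℂ))) - 3) ^ 2)))) +
            (∑ n ∈ (Finset.Icc (-(m : ℤ)) m).erase 0,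
              rhoArch (2 * π * I * n / Real.log p) *
                (8 * (1 - (p : ℂ)⁻¹) * Real.log p / (4 * π * n + 3 * I * Real.log p) ^ 2 *
                  xPrime p n ^ j)) +
            (B₀ * (cayleyInv 0 ^ j * ((-8 : ℂ) / (2 * 0 - 3) ^ 2)) +
              2 * ((1 - (p : ℂ)⁻¹) / Real.log p) *
                deriv (fun z : ℂ => cayleyInv z ^ j * ((-8 : ℂ) / (2 * z - 3) ^ 2)) 0)) := by
  have hp1 : 1 < p := hp.one_lt
  obtain ⟨B₀, hB⟩ := exists_doublePole_structure_product_zero hp1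
  refine ⟨B₀, fun j m hm => ?_⟩
  obtain ⟨g₀, V₀, hV₀, hg₀d, hg₀v, hg₀F⟩ := hB j
  have hp0 : (p : ℂ) ≠ 0 := Nat.cast_ne_zero.2 (by omega)
  have hlogR : 0 < Real.log p := Real.log_pos (by exact_mod_cast hp1)
  have hm1 : (1 : ℝ) ≤ m := by exact_mod_cast hm
  set L : ℝ := Real.log p with hL
  set R : ℝ := (2 * m + 1) * π / L with hR
  set R' : ℝ := 2 * π * (m + 1) / L with hR'
  have hR0 : 0 < R := by positivity
  have hRR' : R < R' := by
    rw [hR, hR', div_lt_div_iff_of_pos_right hlogR]; nlinarith [Real.pi_pos]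
  set zP : ℤ → ℂ := fun n => 2 * π * I * n / L with hzP
  have hzP_im : ∀ n : ℤ, (zP n).im = 2 * π * n / L := fun n => (pr_pole_re_im p n).2
  have hzP_re : ∀ n : ℤ, (zP n).re = 0 := fun n => (pr_pole_re_im p n).1
  have hzP_inj : Function.Injective zP := by
    intro a b h
    have := congrArg Complex.im h
    rw [hzP_im, hzP_im, div_left_inj' hlogR.ne'] at this
    have h2 : (a : ℝ) = b := by nlinarith [Real.pi_pos]
    exact_mod_cast h2
  have hzP_ne : ∀ n : ℤ, n ≠ 0 → zP n ≠ 0 := by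
    intro n hn h
    have := congrArg Complex.im h
    rw [hzP_im, Complex.zero_im] at this
    have : (n : ℝ) = 0 := by
      have h2 := div_eq_zero_iff.1 this
      rcases h2 with h2 | h2
      · nlinarith [Real.pi_pos, mul_eq_zero.1 h2]
      · exact absurd h2 hlogR.ne'
    exact hn (by exact_mod_cast this)
  set aP : ℕ → ℂ := fun n => -(2 * (n : ℂ)) with haP
  have haP_re : ∀ n : ℕ, (aP n).re = -(2 * n) := fun n => by simp [haP]
  have haP_im : ∀ n : ℕ, (aP n).im = 0 := fun n => by simp [haP]
  have haP_inj : Function.Injective aP := by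
    intro a b h
    have := congrArg Complex.re h
    rw [haP_re, haP_re] at this
    exact_mod_cast (by linarith : (a : ℝ) = b)
  set K : ℂ → ℂ := fun z => cayleyInv z ^ j * ((-8 : ℂ) / (2 * z - 3) ^ 2) with hK
  set F : ℂ → ℂ := fun z => rhoArch z * (rhoPrime p z * K z) with hF
  set A : ℂ := 2 * ((1 - (p : ℂ)⁻¹) / L) * K 0 with hA
  set G : ℂ → ℂ := fun z => F z - A / z ^ 2 with hG
  set res : ℕ → ℂ := fun n =>
    ((((-1 : ℝ) ^ n * 2 * (Real.sqrt π * π ^ (2 * n)) / (n ! * Real.Gamma (n + 1 / 2)) : ℝ)) : ℂ)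
    with hres
  set r : ℂ → ℂ := fun q =>
    if q = 0 then B₀ * K 0 + 2 * ((1 - (p : ℂ)⁻¹) / L) * deriv K 0
    else if q.re = 0 then rhoArch q * ((1 - (p : ℂ)⁻¹) / L * K q)
    else res ⌊-q.re / 2⌋₊ * (rhoPrime p q * K q) with hr
  set S1 : Finset ℂ := (Finset.Icc 1 (m - 1)).image aP with hS1
  set S2 : Finset ℂ := ((Finset.Icc (-(m : ℤ)) m).erase 0).image zP with hS2
  set S : Finset ℂ := S1 ∪ S2 ∪ {0} with hS
  set U : Set ℂ := Ioo (1 / 2 - 2 * (m : ℝ) - 1 / 4) 1 ×ℂ Ioo (-R') R' with hU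
  have hUo : IsOpen U := isOpen_Ioo.reProdIm isOpen_Ioo
  have hab : (1 / 2 - 2 * (m : ℝ)) < 1 / 2 := by linarith
  have hcd : -R < R := by linarith
  have hKU : Icc (1 / 2 - 2 * (m : ℝ)) (1 / 2) ×ℂ Icc (-R) R ⊆ U := by
    intro z hz
    rw [mem_reProdIm] at hz ⊢
    exact ⟨⟨by linarith [hz.1.1], by linarith [hz.1.2]⟩, ⟨by linarith [hz.2.1], by linarith [hz.2.2]⟩⟩
  -- membership in the three parts of `S`
  have hmemS1 : ∀ z : ℂ, z ∈ S1 ↔ ∃ n : ℕ, 1 ≤ n ∧ n ≤ m - 1 ∧ aP n = z := by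
    intro z
    rw [hS1, Finset.mem_image]
    constructor
    · rintro ⟨n, hn, rfl⟩
      rw [Finset.mem_Icc] at hn
      exact ⟨n, hn.1, hn.2, rfl⟩
    · rintro ⟨n, h1, h2, rfl⟩
      exact ⟨n, Finset.mem_Icc.2 ⟨h1, h2⟩, rfl⟩
  have hmemS2 : ∀ z : ℂ, z ∈ S2 ↔ ∃ n : ℤ, n ≠ 0 ∧ -(m : ℤ) ≤ n ∧ n ≤ m ∧ zP n = z := by
    intro z
    rw [hS2, Finset.mem_image]
    constructor
    · rintro ⟨n, hn, rfl⟩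
      rw [Finset.mem_erase, Finset.mem_Icc] at hn
      exact ⟨n, hn.1, hn.2.1, hn.2.2, rfl⟩
    · rintro ⟨n, h0, h1, h2, rfl⟩
      exact ⟨n, Finset.mem_erase.2 ⟨h0, Finset.mem_Icc.2 ⟨h1, h2⟩⟩, rfl⟩
  have hmemS : ∀ z : ℂ, z ∈ S ↔ z ∈ S1 ∨ z ∈ S2 ∨ z = 0 := by
    intro z
    rw [hS, Finset.mem_union, Finset.mem_union, Finset.mem_singleton, or_assoc]
  have h0S : (0 : ℂ) ∈ S := (hmemS 0).2 (Or.inr (Or.inr rfl))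
  -- the poles are inside the open rectangle
  have hSsub : (S : Set ℂ) ⊆ Ioo (1 / 2 - 2 * (m : ℝ)) (1 / 2) ×ℂ Ioo (-R) R := by
    intro z hz
    rw [Finset.mem_coe, hmemS] at hz
    rw [mem_reProdIm]
    rcases hz with hz | hz | rfl
    · obtain ⟨n, h1, h2, rfl⟩ := (hmemS1 _).1 hz
      rw [haP_re, haP_im]
      have h2' : (n : ℝ) + 1 ≤ m := by
        have : n + 1 ≤ m := by omega
        exact_mod_cast this
      have h1' : (1 : ℝ) ≤ n := by exact_mod_cast h1
      exact ⟨⟨by linarith, by linarith⟩, ⟨by linarith, by linarith⟩⟩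
    · obtain ⟨n, h0, h1, h2, rfl⟩ := (hmemS2 _).1 hz
      have hn' : |(n : ℝ)| ≤ m := by
        rw [← Int.cast_abs]; exact_mod_cast abs_le.2 ⟨h1, h2⟩
      rw [hzP_re, hzP_im]
      refine ⟨⟨by linarith, by linarith⟩, ?_⟩
      rw [mem_Ioo, hR, neg_lt, lt_div_iff₀ hlogR, ← neg_div, div_mul_cancel₀ _ hlogR.ne',
        div_lt_div_iff_of_pos_right hlogR]
      constructor <;> nlinarith [abs_le.1 hn', Real.pi_pos]
    · simp only [Complex.zero_re, Complex.zero_im, mem_Ioo]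
      exact ⟨⟨by linarith, by linarith⟩, ⟨by linarith, by linarith⟩⟩
  -- `G` is holomorphic on `U` off the poles
  have hGd : DifferentiableOn ℂ G (U \ ↑S) := by
    intro z hz
    obtain ⟨hzU, hzS⟩ := hz
    rw [Finset.mem_coe] at hzS
    rw [hU, mem_reProdIm] at hzU
    have hz0 : z ≠ 0 := fun h => hzS (h ▸ h0S)
    have h23 : (2 * z - 3 : ℂ) ≠ 0 := by
      intro h
      have := congrArg Complex.re h
      simp at this
      linarith [hzU.1.2]
    -- `ρ_∞` is holomorphic at `z`
    have hArch : DifferentiableAt ℂ rhoArch z := by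
      refine differentiableAt_rhoArch fun h => ?_
      obtain ⟨n, hn⟩ := Complex.Gammaℝ_eq_zero_iff.1 h
      rcases Nat.eq_zero_or_pos n with h0 | hpos
      · subst h0; apply hz0; rw [hn]; simp
      · by_cases hnm : n ≤ m - 1
        · exact hzS ((hmemS z).2 (Or.inl ((hmemS1 z).2 ⟨n, hpos, hnm, hn.symm⟩)))
        · have hmn : (m : ℝ) ≤ n := by
            have : m ≤ n := by omega
            exact_mod_cast this
          have := hzU.1.1
          rw [hn] at this
          simp at this
          linarith
    -- `ρ_p` is holomorphic at `z`
    have hPrime : DifferentiableAt ℂ (rhoPrime p) z := by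
      refine differentiableAt_rhoPrime_of_ne hp1 fun h => ?_
      have h1 : (p : ℂ) ^ (-z) = 1 := (sub_eq_zero.1 h).symm
      obtain ⟨k, hk⟩ := (natCast_cpow_neg_eq_one_iff hp1 z).1 h1
      have him : |2 * π * k / L| < R' := by
        have := hzU.2
        rw [hk] at this
        rw [show (2 * π * I * k / Real.log p : ℂ).im = 2 * π * k / L from (pr_pole_re_im p k).2] at this
        exact abs_lt.2 this
      have hk' : |(k : ℝ)| < m + 1 := by
        rw [abs_div, abs_of_pos hlogR, hR', div_lt_div_iff_of_pos_right hlogR, abs_mul,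
          abs_of_pos (by positivity : (0:ℝ) < 2 * π)] at him
        nlinarith [Real.pi_pos, abs_nonneg (k : ℝ)]
      have hkm : |k| ≤ (m : ℤ) := by
        have : |(k : ℝ)| < (m : ℤ) + 1 := by push_cast; exact hk'
        rw [← Int.cast_abs] at this
        exact Int.lt_add_one_iff.1 (by exact_mod_cast this)
      by_cases hk0 : k = 0
      · apply hz0; rw [hk, hk0]; simp
      · exact hzS ((hmemS z).2 (Or.inr (Or.inl ((hmemS2 z).2
          ⟨k, hk0, (abs_le.1 hkm).1, (abs_le.1 hkm).2, hk.symm⟩))))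
    have hFz : DifferentiableAt ℂ F z :=
      hArch.mul (hPrime.mul (differentiableAt_cayleyKernel h23 j))
    have hAz : DifferentiableAt ℂ (fun z : ℂ => A / z ^ 2) z :=
      (differentiableAt_const A).div (differentiableAt_id.pow 2) (pow_ne_zero 2 hz0)
    exact (hFz.sub hAz).differentiableWithinAt
  -- values of the residue function
  have hr0 : r 0 = B₀ * K 0 + 2 * ((1 - (p : ℂ)⁻¹) / L) * deriv K 0 := if_pos rfl
  have hrS1 : ∀ n : ℕ, 1 ≤ n → r (aP n) = res n * (rhoPrime p (aP n) * K (aP n)) := by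
    intro n hn
    have hq0 : aP n ≠ 0 := by
      intro h
      have := congrArg Complex.re h
      rw [haP_re, Complex.zero_re] at this
      have : (n : ℝ) = 0 := by linarith
      have : n = 0 := by exact_mod_cast this
      omega
    have hre : (aP n).re ≠ 0 := by
      rw [haP_re]
      have : (0 : ℝ) < n := by exact_mod_cast hn
      linarith
    show (if aP n = 0 then B₀ * K 0 + 2 * ((1 - (p : ℂ)⁻¹) / L) * deriv K 0
      else if (aP n).re = 0 then rhoArch (aP n) * ((1 - (p : ℂ)⁻¹) / L * K (aP n))
      else res ⌊-(aP n).re / 2⌋₊ * (rhoPrime p (aP n) * K (aP n))) = _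
    rw [if_neg hq0, if_neg hre, haP_re, neg_neg, mul_div_cancel_left₀ _ (two_ne_zero),
      Nat.floor_natCast]
  have hrS2 : ∀ n : ℤ, n ≠ 0 → r (zP n) = rhoArch (zP n) * ((1 - (p : ℂ)⁻¹) / L * K (zP n)) := by
    intro n hn
    show (if zP n = 0 then B₀ * K 0 + 2 * ((1 - (p : ℂ)⁻¹) / L) * deriv K 0
      else if (zP n).re = 0 then rhoArch (zP n) * ((1 - (p : ℂ)⁻¹) / L * K (zP n))
      else res ⌊-(zP n).re / 2⌋₊ * (rhoPrime p (zP n) * K (zP n))) = _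
    rw [if_neg (hzP_ne n hn), if_pos (hzP_re n)]
  -- the local structure at each pole
  have hpole : ∀ q ∈ S, ∃ gq : ℂ → ℂ, ∃ V ∈ 𝓝 q, DifferentiableOn ℂ gq V ∧ gq q = r q ∧
      ∀ z ∈ V, z ≠ q → G z = gq z / (z - q) := by
    intro q hq
    rw [hmemS] at hq
    rcases hq with hq | hq | rfl
    · obtain ⟨n, h1, h2, rfl⟩ := (hmemS1 _).1 hq
      obtain ⟨g, V, hV, hgd, hgv, hgF⟩ := exists_pole_structure_product_archPole hp1 j h1
      have hq0 : aP n ≠ 0 := by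
        intro h
        have := congrArg Complex.re h
        rw [haP_re, Complex.zero_re] at this
        have : (n : ℝ) = 0 := by linarith
        have : n = 0 := by exact_mod_cast this
        omega
      obtain ⟨g', V', hV', hg'd, hg'v, hg'F⟩ :=
        pole_structure_sub_correction (A := A) hq0 hV hgd hgF
      refine ⟨g', V', hV', hg'd, ?_, fun z hz hzq => hg'F z hz hzq⟩
      rw [hg'v, hgv, hrS1 n h1]
    · obtain ⟨n, h0, h1, h2, rfl⟩ := (hmemS2 _).1 hq
      obtain ⟨g, V, hV, hgd, hgv, hgF⟩ := exists_pole_structure_product_primePole hp1 j h0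
      obtain ⟨g', V', hV', hg'd, hg'v, hg'F⟩ :=
        pole_structure_sub_correction (A := A) (hzP_ne n h0) hV hgd hgF
      refine ⟨g', V', hV', hg'd, ?_, fun z hz hzq => hg'F z hz hzq⟩
      rw [hg'v, hgv, hrS2 n h0]
    · refine ⟨g₀, V₀, hV₀, hg₀d, ?_, fun z hz hz0 => ?_⟩
      · rw [hg₀v, hr0]
      · rw [sub_zero, ← hg₀F z hz hz0]
  -- the residue theorem for `G`
  have key := Literature.Analysis.Complex.rectBoundaryIntegral_eq_sum_of_simplePoles hab hcd S G r U
    hUo hKU hSsub hGd hpole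
  -- `∮ F = ∮ G + A ∮ z⁻²` and `∮ z⁻² = 0`
  have hopen : IsOpen (U \ ↑S) := hUo.sdiff (Finset.finite_toSet S).isClosed
  have hbdy : ∀ z : ℂ, z ∈ Icc (1 / 2 - 2 * (m : ℝ)) (1 / 2) ×ℂ Icc (-R) R →
      (z.re = 1 / 2 - 2 * m ∨ z.re = 1 / 2 ∨ z.im = -R ∨ z.im = R) → z ∈ U \ ↑S := by
    intro z hz hb
    refine ⟨hKU hz, fun hzS => ?_⟩
    have := hSsub hzS
    rw [mem_reProdIm, mem_Ioo, mem_Ioo] at this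
    rcases hb with hb | hb | hb | hb <;> linarith [this.1.1, this.1.2, this.2.1, this.2.2]
  have hGc : ∀ z ∈ U \ ↑S, ContinuousAt G z := fun z hz =>
    ((hGd z hz).differentiableAt (hopen.mem_nhds hz)).continuousAt
  have hPc : ∀ z ∈ U \ ↑S, ContinuousAt (fun z : ℂ => A * (z - 0) ^ (-2 : ℤ)) z := by
    intro z hz
    have hz0 : z ≠ 0 := fun h => hz.2 (by rw [Finset.mem_coe, h]; exact h0S)
    exact (((differentiableAt_id.sub_const (0 : ℂ)).zpow (m := -2)
      (Or.inl (by rwa [sub_zero]))).const_mul A).continuousAt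
  have hre_im : ∀ x y : ℝ, ((x : ℂ) + y * I).re = x ∧ ((x : ℂ) + y * I).im = y := fun x y => by
    constructor <;> simp
  have hmem_bot : ∀ x ∈ Icc (1 / 2 - 2 * (m : ℝ)) (1 / 2), ((x : ℂ) + (-R : ℝ) * I) ∈ U \ ↑S := by
    intro x hx
    refine hbdy _ ?_ (Or.inr (Or.inr (Or.inl (hre_im x (-R)).2)))
    rw [mem_reProdIm, (hre_im x (-R)).1, (hre_im x (-R)).2]
    exact ⟨hx, ⟨le_refl _, by linarith⟩⟩
  have hmem_top : ∀ x ∈ Icc (1 / 2 - 2 * (m : ℝ)) (1 / 2), ((x : ℂ) + (R : ℝ) * I) ∈ U \ ↑S := by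
    intro x hx
    refine hbdy _ ?_ (Or.inr (Or.inr (Or.inr (hre_im x R).2)))
    rw [mem_reProdIm, (hre_im x R).1, (hre_im x R).2]
    exact ⟨hx, ⟨by linarith, le_refl _⟩⟩
  have hmem_left : ∀ y ∈ Icc (-R) R, (((1 / 2 - 2 * (m : ℝ) : ℝ) : ℂ) + y * I) ∈ U \ ↑S := by
    intro y hy
    refine hbdy _ ?_ (Or.inl (hre_im _ y).1)
    rw [mem_reProdIm, (hre_im _ y).1, (hre_im _ y).2]
    exact ⟨⟨le_refl _, hab.le⟩, hy⟩
  have hmem_right : ∀ y ∈ Icc (-R) R, (((1 / 2 : ℝ) : ℂ) + y * I) ∈ U \ ↑S := by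
    intro y hy
    refine hbdy _ ?_ (Or.inr (Or.inl (hre_im _ y).1))
    rw [mem_reProdIm, (hre_im _ y).1, (hre_im _ y).2]
    exact ⟨⟨hab.le, le_refl _⟩, hy⟩
  have hFG : F = fun z => G z + A * (z - 0) ^ (-2 : ℤ) := by
    funext z
    simp only [hG, sub_zero, zpow_neg, zpow_ofNat, div_eq_mul_inv]
    ring
  have hzero := Literature.Analysis.Complex.rectBoundaryIntegral_sub_zpow_eq_zero (0 : ℂ) (k := -2)
    (a := 1 / 2 - 2 * (m : ℝ)) (b := 1 / 2) (c := -R) (d := R) (by norm_num)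
    (by simp; linarith) (by simp) (by simp; exact hR0) (by simp; exact hR0)
  rw [hFG, Literature.Analysis.Complex.rectBoundaryIntegral_add hab.le hcd.le
    (fun x hx => hGc _ (hmem_bot x hx)) (fun x hx => hGc _ (hmem_top x hx))
    (fun y hy => hGc _ (hmem_left y hy)) (fun y hy => hGc _ (hmem_right y hy))
    (fun x hx => hPc _ (hmem_bot x hx)) (fun x hx => hPc _ (hmem_top x hx))
    (fun y hy => hPc _ (hmem_left y hy)) (fun y hy => hPc _ (hmem_right y hy)),
    Literature.Analysis.Complex.rectBoundaryIntegral_const_mul, hzero, mul_zero, add_zero, key]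
  -- the sum of the residues
  congr 1
  have hdisj12 : Disjoint S1 S2 := by
    rw [Finset.disjoint_left]
    intro z hz1 hz2
    obtain ⟨n, h1, -, rfl⟩ := (hmemS1 _).1 hz1
    obtain ⟨k, -, -, -, hk⟩ := (hmemS2 _).1 hz2
    have := congrArg Complex.re hk
    rw [hzP_re, haP_re] at this
    have : (n : ℝ) = 0 := by linarith
    have : n = 0 := by exact_mod_cast this
    omega
  have hdisj0 : Disjoint (S1 ∪ S2) {0} := by
    rw [Finset.disjoint_singleton_right, Finset.mem_union, not_or]
    constructor
    · intro h
      obtain ⟨n, h1, -, hn⟩ := (hmemS1 _).1 h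
      have := congrArg Complex.re hn
      rw [haP_re, Complex.zero_re] at this
      have : (n : ℝ) = 0 := by linarith
      have : n = 0 := by exact_mod_cast this
      omega
    · intro h
      obtain ⟨n, h0, -, -, hn⟩ := (hmemS2 _).1 h
      exact hzP_ne n h0 hn
  rw [hS, Finset.sum_union hdisj0, Finset.sum_union hdisj12, Finset.sum_singleton, hS1,
    Finset.sum_image fun a _ b _ h => haP_inj h, hS2, Finset.sum_image fun a _ b _ h => hzP_inj h]
  rw [hr0]
  congr 1
  congr 1
  · refine Finset.sum_congr rfl fun n hn => ?_
    rw [Finset.mem_Icc] at hn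
    rw [hrS1 n hn.1]
  · refine Finset.sum_congr rfl fun n hn => ?_
    rw [Finset.mem_erase] at hn
    rw [hrS2 n hn.1, ← residueCoeff_eq hp1 n j]

/-! ## Letting `m → ∞`: the negative Fourier coefficients of `κκ_p` -/

section Limit

open intervalIntegral

/-! ### Side estimates for `ρ_pR_j` (as in `QuasiInnerPrimeResidues.lean`) -/

/-- `|2z − 3| ≥ 2|Im z|`. [folklore] -/
private theorem pf_two_mul_abs_im_le_norm (z : ℂ) : 2 * |z.im| ≤ ‖2 * z - 3‖ := by
  have h := Complex.abs_im_le_norm (2 * z - 3)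
  have : (2 * z - 3 : ℂ).im = 2 * z.im := by simp
  rw [this, abs_mul, abs_two] at h
  exact h

/-- `|2z − 3| ≥ |2 Re z − 3|`. [folklore] -/
private theorem pf_abs_re_le_norm (z : ℂ) : |2 * z.re - 3| ≤ ‖2 * z - 3‖ := by
  have h := Complex.abs_re_le_norm (2 * z - 3)
  have : (2 * z - 3 : ℂ).re = 2 * z.re - 3 := by simp
  rwa [this] at h

/-- The horizontal sides: `|ρ_pR_j| ≤ 2 log²p/((2m+1)²π²)` on `Im z = (2m+1)π/log p`, `Re z ≤ ½`.
[cite: ConnesConsani2021QuasiInner, §3 (arXiv chunk p0008:L33–L39)] -/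
private theorem pf_norm_rhoPrime_kernel_horizontal_le {p : ℕ} (hp : 1 < p) (j : ℕ) (m : ℤ) {R x : ℝ}
    (hR : R = (2 * m + 1) * π / Real.log p) (hx : x ≤ 1 / 2) :
    ‖rhoPrime p (x + R * I) *
        (cayleyInv (x + R * I) ^ j * ((-8 : ℂ) / (2 * (x + R * I) - 3) ^ 2))‖ ≤
      2 * Real.log p ^ 2 / ((2 * m + 1) ^ 2 * π ^ 2) := by
  have hlogR : 0 < Real.log p := Real.log_pos (by exact_mod_cast hp)
  have hodd : (2 * (m : ℝ) + 1) ≠ 0 := by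
    intro h
    have : (2 * m + 1 : ℤ) = 0 := by exact_mod_cast h
    omega
  have h1 : ‖rhoPrime p (x + R * I)‖ ≤ 1 := by
    rw [hR]; exact norm_rhoPrime_le_one_of_re_le_half hp m hx
  have hre : ((x : ℂ) + R * I).re = x := by simp
  have him : ((x : ℂ) + R * I).im = R := by simp
  have h2 := norm_kernel_le (show ((x : ℂ) + R * I).re ≤ 1 / 2 by rw [hre]; exact hx) j
  have h3 : 2 * |R| ≤ ‖2 * ((x : ℂ) + R * I) - 3‖ := by
    have := pf_two_mul_abs_im_le_norm ((x : ℂ) + R * I)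
    rwa [him] at this
  have hRpos : 0 < 2 * |R| := by
    rw [hR]
    exact mul_pos two_pos
      (abs_pos.2 (div_ne_zero (mul_ne_zero hodd Real.pi_ne_zero) hlogR.ne'))
  rw [norm_mul]
  calc ‖rhoPrime p (x + R * I)‖ *
        ‖cayleyInv (x + R * I) ^ j * ((-8 : ℂ) / (2 * (x + R * I) - 3) ^ 2)‖
      ≤ 1 * (8 / ‖2 * ((x : ℂ) + R * I) - 3‖ ^ 2) := mul_le_mul h1 h2 (norm_nonneg _) zero_le_one
    _ ≤ 8 / (2 * |R|) ^ 2 := by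
        rw [one_mul]
        exact div_le_div_of_nonneg_left (by norm_num) (pow_pos hRpos 2) (pow_le_pow_left₀ hRpos.le h3 2)
    _ = 2 * Real.log p ^ 2 / ((2 * m + 1) ^ 2 * π ^ 2) := by
        rw [mul_pow, sq_abs, hR]
        field_simp
        ring

/-- The left side `Re z = ½ − 2m`, `m ≥ 1`: `|ρ_pR_j| ≤ (1 + p⁻¹)/(p^{3/2} − 1)·8/(4m+2)²`.
[cite: ConnesConsani2021QuasiInner, §3 (arXiv chunk p0008:L40–L46)] -/
private theorem pf_norm_rhoPrime_kernel_left_le {p : ℕ} (hp : 1 < p) (j : ℕ) {m : ℕ} (hm : 1 ≤ m)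
    (y : ℝ) :
    ‖rhoPrime p ((1 / 2 - 2 * m : ℝ) + y * I) * (cayleyInv ((1 / 2 - 2 * m : ℝ) + y * I) ^ j *
        ((-8 : ℂ) / (2 * ((1 / 2 - 2 * m : ℝ) + y * I) - 3) ^ 2))‖ ≤
      (1 + (p : ℝ)⁻¹) / ((p : ℝ) ^ (3 / 2 : ℝ) - 1) * (8 / (4 * m + 2) ^ 2) := by
  have hm1 : (1 : ℝ) ≤ m := by exact_mod_cast hm
  have hp1 : (1 : ℝ) < p := by exact_mod_cast hp
  set z : ℂ := ((1 / 2 - 2 * m : ℝ) : ℂ) + y * I with hz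
  have hre : z.re = 1 / 2 - 2 * m := by simp [hz]
  have h1 : ‖rhoPrime p z‖ ≤ (1 + (p : ℝ)⁻¹) / ((p : ℝ) ^ (3 / 2 : ℝ) - 1) :=
    norm_rhoPrime_le_of_re_le hp (by norm_num) (by rw [hre]; linarith)
  have h2 := norm_kernel_le (show z.re ≤ 1 / 2 by rw [hre]; linarith) j
  have h3 : (4 * m + 2 : ℝ) ≤ ‖2 * z - 3‖ := by
    have := pf_abs_re_le_norm z
    rwa [hre, show (2 * (1 / 2 - 2 * (m : ℝ)) - 3) = -(4 * m + 2) by ring, abs_neg,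
      abs_of_pos (by positivity)] at this
  have hC : 0 ≤ (1 + (p : ℝ)⁻¹) / ((p : ℝ) ^ (3 / 2 : ℝ) - 1) := by
    have : 1 < (p : ℝ) ^ (3 / 2 : ℝ) := Real.one_lt_rpow hp1 (by norm_num)
    exact div_nonneg (by positivity) (by linarith)
  rw [norm_mul]
  calc ‖rhoPrime p z‖ * ‖cayleyInv z ^ j * ((-8 : ℂ) / (2 * z - 3) ^ 2)‖
      ≤ (1 + (p : ℝ)⁻¹) / ((p : ℝ) ^ (3 / 2 : ℝ) - 1) * (8 / ‖2 * z - 3‖ ^ 2) :=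
        mul_le_mul h1 h2 (norm_nonneg _) hC
    _ ≤ (1 + (p : ℝ)⁻¹) / ((p : ℝ) ^ (3 / 2 : ℝ) - 1) * (8 / (4 * m + 2) ^ 2) := by
        gcongr

/-- The right side (critical line): `|ρ_∞ρ_pR_j(½ + iy)| ≤ 2/(1 + y²)` (`|ρ_∞| = |ρ_p| = 1` there).
[cite: ConnesConsani2021QuasiInner, §4.3 (arXiv chunk p0011:L100–L104) with §3 (p0008:L33)] -/
private theorem pf_norm_product_critical_le {p : ℕ} (hp : 1 < p) (j : ℕ) (y : ℝ) :
    ‖rhoArch ((1 / 2 : ℝ) + y * I) * (rhoPrime p ((1 / 2 : ℝ) + y * I) *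
        (cayleyInv ((1 / 2 : ℝ) + y * I) ^ j * ((-8 : ℂ) / (2 * ((1 / 2 : ℝ) + y * I) - 3) ^ 2)))‖ ≤
      2 * (1 + y ^ 2)⁻¹ := by
  have hhalf : (((1 / 2 : ℝ) : ℂ) + y * I) = 1 / 2 + y * I := by push_cast; ring
  rw [norm_mul, norm_mul, hhalf, norm_rhoArch_critical_line y, norm_rhoPrime_critical_line hp y,
    one_mul, one_mul]
  have hre : ((1 : ℂ) / 2 + y * I).re ≤ 1 / 2 := by simp
  refine (norm_kernel_le hre j).trans ?_
  have : ‖2 * (1 / 2 + (y : ℂ) * I) - 3‖ ^ 2 = 4 * (1 + y ^ 2) := by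
    rw [show (2 * (1 / 2 + (y : ℂ) * I) - 3) = ((-2 : ℝ) : ℂ) + ((2 * y : ℝ) : ℂ) * I by
      push_cast; ring, Complex.sq_norm, Complex.normSq_add_mul_I]
    ring
  rw [this]
  apply le_of_eq
  field_simp
  norm_num

/-- Continuity of `y ↦ (ρ_∞ρ_pR_j)(x + iy)` along a vertical line `Re z = x ∉ 2ℤ ∪ {0}`, `x < 3/2`.
[folklore] -/
private theorem pf_continuous_product_vertical {p : ℕ} (hp : 1 < p) (j : ℕ) {x : ℝ}
    (hx0 : x ≠ 0) (hx : x < 3 / 2) (hx2 : ∀ n : ℕ, x ≠ -(2 * (n : ℝ))) :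
    Continuous fun y : ℝ => rhoArch (x + y * I) * (rhoPrime p (x + y * I) *
      (cayleyInv (x + y * I) ^ j * ((-8 : ℂ) / (2 * (x + y * I) - 3) ^ 2))) := by
  have hline : Continuous fun y : ℝ => (x : ℂ) + y * I := by fun_prop
  refine continuous_iff_continuousAt.2 fun y => ?_
  have hre : ((x : ℂ) + y * I).re = x := by simp
  have h23 : (2 * ((x : ℂ) + y * I) - 3) ≠ 0 := by
    intro h
    have := congrArg Complex.re h
    simp at this
    linarith
  have hd : DifferentiableAt ℂ (fun z : ℂ => rhoArch z * (rhoPrime p z *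
      (cayleyInv z ^ j * ((-8 : ℂ) / (2 * z - 3) ^ 2)))) ((x : ℂ) + y * I) :=
    (differentiableAt_rhoArch_of_re (by rw [hre]; exact hx2)).mul
      ((differentiableAt_rhoPrime hp (by rw [hre]; exact hx0)).mul (differentiableAt_cayleyKernel h23 j))
  exact hd.continuousAt.comp (f := fun y : ℝ => (x : ℂ) + y * I) hline.continuousAt

/-- `|½ − N| ≥ ½` for every integer `N`. [folklore] -/
private theorem pf_half_le_abs_half_sub_int (N : ℤ) : (1 / 2 : ℝ) ≤ |1 / 2 - (N : ℝ)| := by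
  rcases le_or_gt N 0 with h | h
  · have : (N : ℝ) ≤ 0 := by exact_mod_cast h
    rw [abs_of_nonneg (by linarith)]; linarith
  · have : (1 : ℝ) ≤ N := by exact_mod_cast h
    rw [abs_of_nonpos (by linarith)]; linarith

/-- On the critical line the change of variables `S¹ → ∂ℂ₋` turns `κκ_p` into `ρ_∞ρ_pR_j/(2π)`:
`π⁻¹(1+t²)⁻¹ψ⁻¹(z)^{j+1}(κκ_p)(ψ⁻¹(z)) = (1/2π)ρ_∞(z)ρ_p(z)R_j(z)`, `z = ½ + it`.
[cite: ConnesConsani2021QuasiInner, Thm 4.4 proof (arXiv chunk p0011:L100–L104)] -/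
private theorem pf_product_integrand_eq (p : ℕ) (j : ℕ) (t : ℝ) :
    (((π⁻¹ * (1 + t ^ 2)⁻¹ : ℝ)) : ℂ) *
        (cayleyInv (1 / 2 + t * I) ^ (j + 1) *
          (kappaArch (cayleyInv (1 / 2 + t * I)) * kappaPrime p (cayleyInv (1 / 2 + t * I)))) =
      (1 / (2 * π) : ℂ) * (rhoArch (1 / 2 + t * I) * (rhoPrime p (1 / 2 + t * I) *
        (cayleyInv (1 / 2 + t * I) ^ j * ((-8 : ℂ) / (2 * (1 / 2 + t * I) - 3) ^ 2)))) := by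
  set z : ℂ := 1 / 2 + (t : ℂ) * I with hzdef
  have hz : z ≠ 3 / 2 := by
    intro h
    have := congrArg Complex.re h
    rw [hzdef] at this
    simp at this
    norm_num at this
  rw [kappaArch, kappaPrime, cayley_cayleyInv hz]
  have hB0 : (2 * z - 3 : ℂ) ≠ 0 := by
    intro h
    have := congrArg Complex.re h
    rw [hzdef] at this
    norm_num at this
  have hπ : (π : ℂ) ≠ 0 := ofReal_ne_zero.mpr Real.pi_pos.ne'
  have hq : (((1 + t ^ 2 : ℝ)) : ℂ) = -((2 * z + 1) * (2 * z - 3)) / 4 := by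
    rw [hzdef]
    push_cast
    linear_combination ((t : ℂ) ^ 2) * I_sq
  have hq0 : (((1 + t ^ 2 : ℝ)) : ℂ) ≠ 0 := by
    exact_mod_cast (by positivity : (1 + t ^ 2 : ℝ) ≠ 0)
  have hA0 : (2 * z + 1 : ℂ) ≠ 0 := by
    intro h
    rw [h, zero_mul, neg_zero, zero_div] at hq
    exact hq0 hq
  have hcast : (((π⁻¹ * (1 + t ^ 2)⁻¹ : ℝ)) : ℂ) = (π : ℂ)⁻¹ * ((((1 + t ^ 2 : ℝ)) : ℂ))⁻¹ := by
    push_cast; ring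
  rw [hcast, hq, pow_succ, cayleyInv]
  field_simp
  ring

/-- `Γ(n + ½) ≥ ½` for `n ≥ 1` (`Γ(3/2) = √π/2`, `Γ(x+1) = xΓ(x)`). [folklore] -/
private theorem pf_half_le_Gamma {n : ℕ} (hn : 1 ≤ n) : (1 / 2 : ℝ) ≤ Real.Gamma (n + 1 / 2) := by
  induction n with
  | zero => omega
  | succ k ih =>
    rcases Nat.eq_zero_or_pos k with h0 | hk
    · subst h0
      have h : Real.Gamma ((((0 + 1 : ℕ)) : ℝ) + 1 / 2) = 1 / 2 * Real.Gamma (1 / 2) := by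
        rw [show ((((0 + 1 : ℕ)) : ℝ) + 1 / 2) = 1 / 2 + 1 by push_cast; norm_num,
          Real.Gamma_add_one (by norm_num)]
      rw [h, Real.Gamma_one_half_eq]
      have : 1 ≤ Real.sqrt π := by
        rw [show (1 : ℝ) = Real.sqrt 1 from Real.sqrt_one.symm]
        exact Real.sqrt_le_sqrt (by linarith [Real.pi_gt_three])
      linarith
    · have ih' := ih hk
      have hk1 : (1 : ℝ) ≤ k := by exact_mod_cast hk
      have h : Real.Gamma ((((k + 1 : ℕ)) : ℝ) + 1 / 2) = ((k : ℝ) + 1 / 2) * Real.Gamma (k + 1 / 2) := by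
        rw [show ((((k + 1 : ℕ)) : ℝ) + 1 / 2) = ((k : ℝ) + 1 / 2) + 1 by push_cast; ring,
          Real.Gamma_add_one (by positivity)]
      rw [h]
      nlinarith

/-! ### The limit `m → ∞` -/

/-- **The negative Fourier coefficients of `κκ_p` as the sum of the residues of the three kinds of
poles** («`a^{(p,∞)}_{−k} = Σ_𝓡 Res(ρ_∞(z)ρ_p(z)((2z+1)/(2z−3))^{k−1}(−8)/(2z−3)²)` … The poles are of
three kinds …»), `k = j + 1`: there is ONE constant `B₀` (that of
`exists_rectBoundaryIntegral_rhoArch_rhoPrime_kernel`) such that for every `j` the families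
`α_n = r_nρ_p(−2n)R_j(−2n)` (`n ≥ 1`) and `β_n = ρ_∞(2πin/log p)·8(1−1/p)log p(4πn+3i log p)^{−2}x_p(n)^j`
(`n ≠ 0`, `β_0 := 0`) are summable and
`(κκ_p)^(−(j+1)) = Σ_{n≥0} α_{n+1} + Σ_{n∈ℤ} β_n + (B₀R_j(0) + (2(1−1/p)/log p)R_j′(0))`
(rectangles `[½−2m, ½] × [±(2m+1)π/log p]`, `m → ∞`; the three far sides tend to `0`, the right side to
`(1/2π)∫_ℝ ρ_∞ρ_pR_j(½+iy)dy = (κκ_p)^(−(j+1))` by seat t17's change of variables).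
[cite: ConnesConsani2021QuasiInner, Thm 4.4 (ii) proof (arXiv chunk p0011:L100–p0012:L18)] -/
theorem exists_fourierCoeff_kappaArch_mul_kappaPrime_neg {p : ℕ} (hp : p.Prime) :
    ∃ B₀ : ℂ, ∀ j : ℕ,
      Summable (fun n : ℕ =>
        ((((-1 : ℝ) ^ (n + 1) * 2 * (Real.sqrt π * π ^ (2 * (n + 1))) /
            ((n + 1) ! * Real.Gamma ((n + 1 : ℕ) + 1 / 2)) : ℝ)) : ℂ) *
          (rhoPrime p (-(2 * ((n + 1 : ℕ) : ℂ))) *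
            (cayleyInv (-(2 * ((n + 1 : ℕ) : ℂ))) ^ j *
              ((-8 : ℂ) / (2 * (-(2 * ((n + 1 : ℕ) : ℂ))) - 3) ^ 2)))) ∧
      Summable (fun n : ℤ => if n = 0 then (0 : ℂ) else
        rhoArch (2 * π * I * n / Real.log p) *
          (8 * (1 - (p : ℂ)⁻¹) * Real.log p / (4 * π * n + 3 * I * Real.log p) ^ 2 *
            xPrime p n ^ j)) ∧
      fourierCoeff (T := 1) (circleRestrict 1 fun v => kappaArch v * kappaPrime p v) (-(j + 1 : ℤ)) =
        (∑' n : ℕ,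
          ((((-1 : ℝ) ^ (n + 1) * 2 * (Real.sqrt π * π ^ (2 * (n + 1))) /
              ((n + 1) ! * Real.Gamma ((n + 1 : ℕ) + 1 / 2)) : ℝ)) : ℂ) *
            (rhoPrime p (-(2 * ((n + 1 : ℕ) : ℂ))) *
              (cayleyInv (-(2 * ((n + 1 : ℕ) : ℂ))) ^ j *
                ((-8 : ℂ) / (2 * (-(2 * ((n + 1 : ℕ) : ℂ))) - 3) ^ 2)))) +
        (∑' n : ℤ, if n = 0 then (0 : ℂ) else
          rhoArch (2 * π * I * n / Real.log p) *
            (8 * (1 - (p : ℂ)⁻¹) * Real.log p / (4 * π * n + 3 * I * Real.log p) ^ 2 *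
              xPrime p n ^ j)) +
        (B₀ * (cayleyInv 0 ^ j * ((-8 : ℂ) / (2 * 0 - 3) ^ 2)) +
          2 * ((1 - (p : ℂ)⁻¹) / Real.log p) *
            deriv (fun z : ℂ => cayleyInv z ^ j * ((-8 : ℂ) / (2 * z - 3) ^ 2)) 0) := by
  have hp1 : 1 < p := hp.one_lt
  have hp1R : (1 : ℝ) < p := by exact_mod_cast hp1
  have hp2R : (2 : ℝ) ≤ p := by exact_mod_cast hp.two_le
  have hlogR : 0 < Real.log p := Real.log_pos hp1R
  obtain ⟨B₀, hrect⟩ := exists_rectBoundaryIntegral_rhoArch_rhoPrime_kernel hp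
  refine ⟨B₀, fun j => ?_⟩
  -- notation: the two residue families and the kernel
  set K : ℂ → ℂ := fun z : ℂ => cayleyInv z ^ j * ((-8 : ℂ) / (2 * z - 3) ^ 2) with hK
  set α : ℕ → ℂ := fun n =>
    ((((-1 : ℝ) ^ n * 2 * (Real.sqrt π * π ^ (2 * n)) / (n ! * Real.Gamma (n + 1 / 2)) : ℝ)) : ℂ) *
      (rhoPrime p (-(2 * (n : ℂ))) * K (-(2 * (n : ℂ)))) with hα
  set β : ℤ → ℂ := fun n => if n = 0 then (0 : ℂ) else
    rhoArch (2 * π * I * n / Real.log p) *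
      (8 * (1 - (p : ℂ)⁻¹) * Real.log p / (4 * π * n + 3 * I * Real.log p) ^ 2 * xPrime p n ^ j)
    with hβ
  set Bj : ℂ := B₀ * K 0 + 2 * ((1 - (p : ℂ)⁻¹) / Real.log p) * deriv K 0 with hBj
  -- the uniform bound of `ρ_∞` at distance `≥ δ` from `2ℤ` in `Re z ≤ ½`
  set δ : ℝ := min (1 / 2) (2 * π / Real.log p) with hδ
  have hδ0 : 0 < δ := lt_min (by norm_num) (by positivity)
  obtain ⟨C, hC0, hC⟩ := exists_norm_rhoArch_le hδ0
  ---------------------------------------------------------------- summability of `α (n+1)`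
  have hαb : ∀ n : ℕ, 1 ≤ n → ‖α n‖ ≤
      (2 * Real.sqrt π * 2) * ((1 + (p : ℝ)⁻¹) / ((p : ℝ) ^ (2 : ℝ) - 1)) * 8 * ((π ^ 2) ^ n / n !) := by
    intro n hn
    have hn1 : (1 : ℝ) ≤ n := by exact_mod_cast hn
    -- the residue of `ρ_∞`
    have hG : (1 / 2 : ℝ) ≤ Real.Gamma (n + 1 / 2) := pf_half_le_Gamma hn
    have hΓpos : 0 < Real.Gamma (n + 1 / 2) := Real.Gamma_pos_of_pos (by positivity)
    have hr : ‖((((-1 : ℝ) ^ n * 2 * (Real.sqrt π * π ^ (2 * n)) / (n ! * Real.Gamma (n + 1 / 2)) : ℝ)) : ℂ)‖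
        ≤ 2 * Real.sqrt π * 2 * ((π ^ 2) ^ n / n !) := by
      rw [Complex.norm_real, Real.norm_eq_abs,
        show ((-1 : ℝ) ^ n * 2 * (Real.sqrt π * π ^ (2 * n)) / (n ! * Real.Gamma (n + 1 / 2))) =
          (-1 : ℝ) ^ n * (2 * (Real.sqrt π * π ^ (2 * n)) / (n ! * Real.Gamma (n + 1 / 2))) by ring,
        abs_mul, abs_pow, abs_neg, abs_one, one_pow, one_mul, abs_of_pos (by positivity)]
      have h1 : 1 / Real.Gamma (n + 1 / 2) ≤ 2 := by
        rw [div_le_iff₀ hΓpos]; linarith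
      calc 2 * (Real.sqrt π * π ^ (2 * n)) / (n ! * Real.Gamma (n + 1 / 2))
          = (2 * Real.sqrt π * ((π ^ 2) ^ n / n !)) * (1 / Real.Gamma (n + 1 / 2)) := by
            rw [pow_mul]; field_simp
        _ ≤ (2 * Real.sqrt π * ((π ^ 2) ^ n / n !)) * 2 := mul_le_mul_of_nonneg_left h1 (by positivity)
        _ = 2 * Real.sqrt π * 2 * ((π ^ 2) ^ n / n !) := by ring
    -- `ρ_p(−2n)` (Lemma 3.1 (iii), `ε = 2`)
    have hre_n : (-(2 * (n : ℂ))).re = -(2 * n) := by simp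
    have hρ : ‖rhoPrime p (-(2 * (n : ℂ)))‖ ≤ (1 + (p : ℝ)⁻¹) / ((p : ℝ) ^ (2 : ℝ) - 1) :=
      norm_rhoPrime_le_of_re_le hp1 (by norm_num) (by rw [hre_n]; linarith)
    -- the kernel
    have hKn : ‖K (-(2 * (n : ℂ)))‖ ≤ 8 := by
      have h1 := norm_kernel_le (show (-(2 * (n : ℂ))).re ≤ 1 / 2 by rw [hre_n]; linarith) j
      refine h1.trans ?_
      have h2 : (4 : ℝ) ≤ ‖2 * (-(2 * (n : ℂ))) - 3‖ := by
        have := pf_abs_re_le_norm (-(2 * (n : ℂ)))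
        have e : (2 * (-(2 * (n : ℂ))).re - 3) = -(4 * n + 3) := by simp; ring
        rw [e, abs_neg, abs_of_pos (by positivity)] at this
        linarith
      calc (8 : ℝ) / ‖2 * (-(2 * (n : ℂ))) - 3‖ ^ 2 ≤ 8 / 4 ^ 2 :=
            div_le_div_of_nonneg_left (by norm_num) (by norm_num) (pow_le_pow_left₀ (by norm_num) h2 2)
        _ ≤ 8 := by norm_num
    have hC1 : 0 ≤ (1 + (p : ℝ)⁻¹) / ((p : ℝ) ^ (2 : ℝ) - 1) := by
      have : 1 < (p : ℝ) ^ (2 : ℝ) := Real.one_lt_rpow hp1R (by norm_num)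
      exact div_nonneg (by positivity) (by linarith)
    simp only [hα]
    rw [norm_mul, norm_mul]
    calc _ ≤ (2 * Real.sqrt π * 2 * ((π ^ 2) ^ n / n !)) *
          (((1 + (p : ℝ)⁻¹) / ((p : ℝ) ^ (2 : ℝ) - 1)) * 8) := by
          refine mul_le_mul hr (mul_le_mul hρ hKn (norm_nonneg _) hC1) (by positivity) (by positivity)
      _ = _ := by ring
  have hαs : Summable (fun n : ℕ => α (n + 1)) := by
    have hmaj : Summable fun n : ℕ =>
        (2 * Real.sqrt π * 2) * ((1 + (p : ℝ)⁻¹) / ((p : ℝ) ^ (2 : ℝ) - 1)) * 8 *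
          ((π ^ 2) ^ (n + 1) / (n + 1) !) := by
      have h0 := Real.summable_pow_div_factorial (π ^ 2)
      have h1 : Summable fun n : ℕ => (π ^ 2) ^ (n + 1) / ((n + 1) ! : ℝ) :=
        (summable_nat_add_iff 1).2 h0
      exact h1.mul_left _
    refine Summable.of_norm_bounded hmaj fun n => ?_
    exact hαb (n + 1) (by omega)
  ---------------------------------------------------------------- summability of `β`
  have hβb : ∀ n : ℤ, ‖β n‖ ≤ C * ‖8 * (1 - (p : ℂ)⁻¹) * Real.log p /
      (4 * π * n + 3 * I * Real.log p) ^ 2 * xPrime p n ^ j‖ := by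
    intro n
    by_cases hn : n = 0
    · simp only [hβ, hn, if_true, norm_zero]
      positivity
    · simp only [hβ, hn, if_false]
      rw [norm_mul]
      refine mul_le_mul_of_nonneg_right ?_ (norm_nonneg _)
      refine hC _ ?_ ?_
      · rw [Complex.div_ofReal_re]; simp
      · intro k
        have him : (2 * π * I * n / Real.log p - 2 * (k : ℂ) : ℂ).im = 2 * π * n / Real.log p := by
          rw [Complex.sub_im, Complex.div_ofReal_im]; simp
        refine le_trans ?_ (Complex.abs_im_le_norm _)
        rw [him]
        have hn1 : (1 : ℝ) ≤ |(n : ℝ)| := by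
          rw [← Int.cast_abs]; exact_mod_cast Int.one_le_abs hn
        calc δ ≤ 2 * π / Real.log p := min_le_right _ _
          _ ≤ |2 * π * (n : ℝ) / Real.log p| := by
              rw [abs_div, abs_of_pos hlogR, div_le_div_iff_of_pos_right hlogR, abs_mul,
                abs_of_pos (by positivity : (0:ℝ) < 2 * π)]
              nlinarith [Real.pi_pos]
  have hβs : Summable β :=
    Summable.of_norm_bounded ((summable_residues_rhoPrime_kernel hp1 j).norm.mul_left C) hβb
  refine ⟨?_, hβs, ?_⟩
  · convert hαs using 1
  ---------------------------------------------------------------- the partial sums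
  have h_partial : Tendsto (fun m : ℕ =>
      (∑ n ∈ Finset.Icc 1 (m - 1), α n) +
        (∑ n ∈ (Finset.Icc (-(m : ℤ)) m).erase 0,
          rhoArch (2 * π * I * n / Real.log p) *
            (8 * (1 - (p : ℂ)⁻¹) * Real.log p / (4 * π * n + 3 * I * Real.log p) ^ 2 *
              xPrime p n ^ j)) + Bj)
      atTop (𝓝 ((∑' n : ℕ, α (n + 1)) + (∑' n : ℤ, β n) + Bj)) := by
    refine Tendsto.add (Tendsto.add ?_ ?_) tendsto_const_nhds
    · -- `Σ_{1 ≤ n ≤ m−1} α_n = Σ_{k < m−1} α_{k+1} → Σ' α_{k+1}`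
      have h1 := hαs.hasSum.tendsto_sum_nat.comp (tendsto_sub_atTop_nat 1)
      refine h1.congr fun m => ?_
      simp only [Function.comp_apply]
      have hI : Finset.Icc 1 (m - 1) = Finset.Ico 1 m := by
        ext n; simp only [Finset.mem_Icc, Finset.mem_Ico]; omega
      rw [hI, Finset.sum_Ico_eq_sum_range]
      refine Finset.sum_congr rfl fun k _ => ?_
      rw [add_comm]
    · -- `Σ_{0 < |n| ≤ m} … = Σ_{|n| ≤ m} β_n → Σ' β`
      have h1 := hβs.hasSum.comp Finset.tendsto_Icc_neg
      refine h1.congr fun m => ?_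
      simp only [Function.comp_apply]
      classical
      rw [← Finset.sum_erase (Finset.Icc (-(m : ℤ)) m) (show β 0 = 0 by simp [hβ])]
      refine Finset.sum_congr rfl fun n hn => ?_
      rw [Finset.mem_erase] at hn
      simp only [hβ, hn.1, if_false]
  ---------------------------------------------------------------- the sides of the rectangles
  have hR : Tendsto (fun m : ℕ => (2 * (m : ℝ) + 1) * π / Real.log p) atTop atTop :=
    ((tendsto_atTop_add_const_right _ _ (tendsto_natCast_atTop_atTop.const_mul_atTop
      (by norm_num : (0 : ℝ) < 2))).atTop_mul_const Real.pi_pos).atTop_div_const hlogR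
  have h_small₁ : Tendsto (fun m : ℕ => C * (Real.log p ^ 2 / π ^ 2) / (m : ℝ)) atTop (𝓝 0) :=
    tendsto_const_div_atTop_nhds_zero_nat _
  have h_small₂ : Tendsto (fun m : ℕ => C * ((1 + (p : ℝ)⁻¹) / ((p : ℝ) ^ (3 / 2 : ℝ) - 1) *
      (4 * π / Real.log p)) / (m : ℝ)) atTop (𝓝 0) :=
    tendsto_const_div_atTop_nhds_zero_nat _
  -- `ρ_∞` on the horizontal sides `Im z = ±(2m+1)π/log p`, `m ≥ 1`
  have hArch_h : ∀ (m : ℕ), 1 ≤ m → ∀ (x R : ℝ), x ≤ 1 / 2 → |R| = (2 * m + 1) * π / Real.log p →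
      ‖rhoArch ((x : ℂ) + R * I)‖ ≤ C := by
    intro m hm x R hx hRabs
    have hm1 : (1 : ℝ) ≤ m := by exact_mod_cast hm
    have hre : ((x : ℂ) + R * I).re = x := by simp
    refine hC _ (by rw [hre]; exact hx) fun k => ?_
    refine le_trans ?_ (Complex.abs_im_le_norm _)
    have : (((x : ℂ) + R * I) - 2 * (k : ℂ)).im = R := by simp
    rw [this, hRabs]
    calc δ ≤ 2 * π / Real.log p := min_le_right _ _
      _ ≤ (2 * m + 1) * π / Real.log p := by
          rw [div_le_div_iff_of_pos_right hlogR]; nlinarith [Real.pi_pos]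
  -- `ρ_∞` on the left side `Re z = ½ − 2m`
  have hArch_l : ∀ (m : ℕ) (y : ℝ), ‖rhoArch ((((1 / 2 - 2 * (m : ℝ) : ℝ)) : ℂ) + y * I)‖ ≤ C := by
    intro m y
    have hre : ((((1 / 2 - 2 * (m : ℝ) : ℝ)) : ℂ) + y * I).re = 1 / 2 - 2 * m := by simp
    refine hC _ (by rw [hre]; linarith [(Nat.cast_nonneg m : (0 : ℝ) ≤ m)]) fun k => ?_
    refine le_trans ?_ (Complex.abs_re_le_norm _)
    have : ((((1 / 2 - 2 * (m : ℝ) : ℝ) : ℂ) + y * I) - 2 * (k : ℂ)).re = 1 / 2 - ((2 * (m + k) : ℤ) : ℝ) := by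
      simp; ring
    rw [this]
    exact (min_le_left _ _).trans (pf_half_le_abs_half_sub_int _)
  -- the right side converges to the line integral
  have hint : Integrable fun y : ℝ => rhoArch ((1 / 2 : ℝ) + y * I) * (rhoPrime p ((1 / 2 : ℝ) + y * I) *
      (cayleyInv ((1 / 2 : ℝ) + y * I) ^ j * ((-8 : ℂ) / (2 * ((1 / 2 : ℝ) + y * I) - 3) ^ 2))) := by
    refine Integrable.mono' (integrable_inv_one_add_sq.const_mul 2)
      (pf_continuous_product_vertical hp1 j (by norm_num) (by norm_num) fun n => by
        have : (0 : ℝ) ≤ n := Nat.cast_nonneg n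
        linarith).aestronglyMeasurable
      (ae_of_all _ fun y => pf_norm_product_critical_le hp1 j y)
  have h_right : Tendsto (fun m : ℕ =>
      ∫ y in (-((2 * m + 1) * π / Real.log p))..((2 * m + 1) * π / Real.log p),
        rhoArch ((1 / 2 : ℝ) + y * I) * (rhoPrime p ((1 / 2 : ℝ) + y * I) *
          (cayleyInv ((1 / 2 : ℝ) + y * I) ^ j * ((-8 : ℂ) / (2 * ((1 / 2 : ℝ) + y * I) - 3) ^ 2))))
      atTop (𝓝 (∫ y : ℝ, rhoArch ((1 / 2 : ℝ) + y * I) * (rhoPrime p ((1 / 2 : ℝ) + y * I) *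
          (cayleyInv ((1 / 2 : ℝ) + y * I) ^ j * ((-8 : ℂ) / (2 * ((1 / 2 : ℝ) + y * I) - 3) ^ 2))))) :=
    intervalIntegral_tendsto_integral hint (tendsto_neg_atTop_atBot.comp hR) hR
  -- the top side tends to `0`
  have h_top : Tendsto (fun m : ℕ => ∫ x in (1 / 2 - 2 * m : ℝ)..(1 / 2 : ℝ),
      rhoArch (x + ((2 * m + 1) * π / Real.log p : ℝ) * I) *
        (rhoPrime p (x + ((2 * m + 1) * π / Real.log p : ℝ) * I) *
          (cayleyInv (x + ((2 * m + 1) * π / Real.log p : ℝ) * I) ^ j *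
            ((-8 : ℂ) / (2 * (x + ((2 * m + 1) * π / Real.log p : ℝ) * I) - 3) ^ 2)))) atTop (𝓝 0) := by
    refine squeeze_zero_norm' ?_ h_small₁
    filter_upwards [eventually_ge_atTop 1] with m hm
    have hm1 : (1 : ℝ) ≤ m := by exact_mod_cast hm
    refine (intervalIntegral.norm_integral_le_of_norm_le_const
      (C := C * (2 * Real.log p ^ 2 / ((2 * ((m : ℤ) : ℝ) + 1) ^ 2 * π ^ 2))) fun x hx => ?_).trans ?_
    · have hx2 : x ≤ 1 / 2 := by rw [Set.uIoc_of_le (by linarith)] at hx; exact hx.2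
      rw [norm_mul]
      exact mul_le_mul (hArch_h m hm x _ hx2 (abs_of_pos (by positivity)))
        (pf_norm_rhoPrime_kernel_horizontal_le hp1 j (m : ℤ) (by push_cast; ring) hx2)
        (norm_nonneg _) hC0
    · have hfrac : 4 * (m : ℝ) / (2 * m + 1) ^ 2 ≤ 1 / m := by
        rw [div_le_div_iff₀ (by positivity) (by positivity)]
        nlinarith
      calc C * (2 * Real.log p ^ 2 / ((2 * ((m : ℤ) : ℝ) + 1) ^ 2 * π ^ 2)) *
            |1 / 2 - (1 / 2 - 2 * (m : ℝ))|
          = C * (Real.log p ^ 2 / π ^ 2) * (4 * m / (2 * m + 1) ^ 2) := by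
            push_cast
            rw [abs_of_nonneg (by linarith)]
            field_simp
            ring
        _ ≤ C * (Real.log p ^ 2 / π ^ 2) * (1 / m) := mul_le_mul_of_nonneg_left hfrac (by positivity)
        _ = C * (Real.log p ^ 2 / π ^ 2) / m := by ring
  -- the bottom side tends to `0`
  have h_bot : Tendsto (fun m : ℕ => ∫ x in (1 / 2 - 2 * m : ℝ)..(1 / 2 : ℝ),
      rhoArch (x + (-((2 * m + 1) * π / Real.log p) : ℝ) * I) *
        (rhoPrime p (x + (-((2 * m + 1) * π / Real.log p) : ℝ) * I) *
          (cayleyInv (x + (-((2 * m + 1) * π / Real.log p) : ℝ) * I) ^ j *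
            ((-8 : ℂ) / (2 * (x + (-((2 * m + 1) * π / Real.log p) : ℝ) * I) - 3) ^ 2))))
      atTop (𝓝 0) := by
    refine squeeze_zero_norm' ?_ h_small₁
    filter_upwards [eventually_ge_atTop 1] with m hm
    have hm1 : (1 : ℝ) ≤ m := by exact_mod_cast hm
    refine (intervalIntegral.norm_integral_le_of_norm_le_const
      (C := C * (2 * Real.log p ^ 2 / ((2 * ((-(m : ℤ) - 1 : ℤ) : ℝ) + 1) ^ 2 * π ^ 2)))
      fun x hx => ?_).trans ?_
    · have hx2 : x ≤ 1 / 2 := by rw [Set.uIoc_of_le (by linarith)] at hx; exact hx.2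
      rw [norm_mul]
      refine mul_le_mul (hArch_h m hm x _ hx2 ?_)
        (pf_norm_rhoPrime_kernel_horizontal_le hp1 j (-(m : ℤ) - 1) (by push_cast; ring) hx2)
        (norm_nonneg _) hC0
      rw [abs_neg, abs_of_pos (by positivity)]
    · have hfrac : 4 * (m : ℝ) / (2 * m + 1) ^ 2 ≤ 1 / m := by
        rw [div_le_div_iff₀ (by positivity) (by positivity)]
        nlinarith
      calc C * (2 * Real.log p ^ 2 / ((2 * ((-(m : ℤ) - 1 : ℤ) : ℝ) + 1) ^ 2 * π ^ 2)) *
            |1 / 2 - (1 / 2 - 2 * (m : ℝ))|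
          = C * (Real.log p ^ 2 / π ^ 2) * (4 * m / (2 * m + 1) ^ 2) := by
            push_cast
            rw [abs_of_nonneg (by linarith),
              show (2 * (-(m : ℝ) - 1) + 1) ^ 2 = (2 * m + 1) ^ 2 by ring]
            field_simp
            ring
        _ ≤ C * (Real.log p ^ 2 / π ^ 2) * (1 / m) := mul_le_mul_of_nonneg_left hfrac (by positivity)
        _ = C * (Real.log p ^ 2 / π ^ 2) / m := by ring
  -- the left side tends to `0`
  have h_left : Tendsto (fun m : ℕ =>
      ∫ y in (-((2 * m + 1) * π / Real.log p))..((2 * m + 1) * π / Real.log p),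
        rhoArch ((1 / 2 - 2 * m : ℝ) + y * I) * (rhoPrime p ((1 / 2 - 2 * m : ℝ) + y * I) *
          (cayleyInv ((1 / 2 - 2 * m : ℝ) + y * I) ^ j *
            ((-8 : ℂ) / (2 * ((1 / 2 - 2 * m : ℝ) + y * I) - 3) ^ 2)))) atTop (𝓝 0) := by
    refine squeeze_zero_norm' ?_ h_small₂
    filter_upwards [eventually_ge_atTop 1] with m hm
    have hm1 : (1 : ℝ) ≤ m := by exact_mod_cast hm
    have hCp : 0 ≤ (1 + (p : ℝ)⁻¹) / ((p : ℝ) ^ (3 / 2 : ℝ) - 1) := by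
      have : 1 < (p : ℝ) ^ (3 / 2 : ℝ) := Real.one_lt_rpow hp1R (by norm_num)
      exact div_nonneg (by positivity) (by linarith)
    refine (intervalIntegral.norm_integral_le_of_norm_le_const
      (C := C * ((1 + (p : ℝ)⁻¹) / ((p : ℝ) ^ (3 / 2 : ℝ) - 1) * (8 / (4 * m + 2) ^ 2)))
      fun y _ => ?_).trans ?_
    · rw [norm_mul]
      exact mul_le_mul (hArch_l m y) (pf_norm_rhoPrime_kernel_left_le hp1 j hm y) (norm_nonneg _) hC0
    calc C * ((1 + (p : ℝ)⁻¹) / ((p : ℝ) ^ (3 / 2 : ℝ) - 1) * (8 / (4 * m + 2) ^ 2)) *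
          |(2 * m + 1) * π / Real.log p - -((2 * m + 1) * π / Real.log p)|
        = C * ((1 + (p : ℝ)⁻¹) / ((p : ℝ) ^ (3 / 2 : ℝ) - 1) * (4 * π / Real.log p)) *
            (1 / (2 * m + 1)) := by
          rw [sub_neg_eq_add, abs_of_nonneg (by positivity)]
          field_simp
          ring
      _ ≤ C * ((1 + (p : ℝ)⁻¹) / ((p : ℝ) ^ (3 / 2 : ℝ) - 1) * (4 * π / Real.log p)) * (1 / m) := by
          gcongr
          linarith
      _ = _ := by ring
  -- the boundary integrals converge
  have h_box : Tendsto (fun m : ℕ => Literature.Analysis.Complex.rectBoundaryIntegral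
        (fun z : ℂ => rhoArch z * (rhoPrime p z * (cayleyInv z ^ j * ((-8 : ℂ) / (2 * z - 3) ^ 2))))
        (1 / 2 - 2 * m) (1 / 2) (-((2 * m + 1) * π / Real.log p)) ((2 * m + 1) * π / Real.log p))
      atTop (𝓝 (0 - 0 + I * (∫ y : ℝ, rhoArch ((1 / 2 : ℝ) + y * I) * (rhoPrime p ((1 / 2 : ℝ) + y * I) *
          (cayleyInv ((1 / 2 : ℝ) + y * I) ^ j * ((-8 : ℂ) / (2 * ((1 / 2 : ℝ) + y * I) - 3) ^ 2)))) -
          I * 0)) :=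
    ((h_bot.sub h_top).add (h_right.const_mul I)).sub (h_left.const_mul I)
  -- … and by the residue formula they are `2πi` times the partial sums
  have h2πI : (2 * π * I : ℂ) ≠ 0 := by simp [Real.pi_ne_zero, I_ne_zero]
  have h_val : Tendsto (fun m : ℕ =>
      (∑ n ∈ Finset.Icc 1 (m - 1), α n) +
        (∑ n ∈ (Finset.Icc (-(m : ℤ)) m).erase 0,
          rhoArch (2 * π * I * n / Real.log p) *
            (8 * (1 - (p : ℂ)⁻¹) * Real.log p / (4 * π * n + 3 * I * Real.log p) ^ 2 *
              xPrime p n ^ j)) + Bj)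
      atTop (𝓝 (1 / (2 * π * I) * (0 - 0 + I * (∫ y : ℝ, rhoArch ((1 / 2 : ℝ) + y * I) *
        (rhoPrime p ((1 / 2 : ℝ) + y * I) *
          (cayleyInv ((1 / 2 : ℝ) + y * I) ^ j * ((-8 : ℂ) / (2 * ((1 / 2 : ℝ) + y * I) - 3) ^ 2)))) -
          I * 0))) := by
    refine (h_box.const_mul (1 / (2 * π * I))).congr' ?_
    filter_upwards [eventually_ge_atTop 1] with m hm
    rw [hrect j m hm, ← mul_assoc, one_div_mul_cancel h2πI, one_mul]
  have h_eq := tendsto_nhds_unique h_partial h_val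
  -- the Fourier coefficient is `(1/2π)` times the line integral
  have hhalf : ∀ y : ℝ, (((1 / 2 : ℝ) : ℂ) + y * I) = 1 / 2 + y * I := fun y => by push_cast; ring
  simp_rw [hhalf] at h_eq
  rw [show (-(j + 1 : ℤ)) = -((j + 1 : ℕ) : ℤ) by push_cast; ring,
    fourierCoeff_circleRestrict_neg_eq_integral (fun v => kappaArch v * kappaPrime p v) (j + 1)]
  simp_rw [pf_product_integrand_eq p j, MeasureTheory.integral_const_mul]
  rw [show (1 / (2 * π) : ℂ) * (∫ y : ℝ, rhoArch (1 / 2 + y * I) * (rhoPrime p (1 / 2 + y * I) *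
        (cayleyInv (1 / 2 + y * I) ^ j * ((-8 : ℂ) / (2 * (1 / 2 + y * I) - 3) ^ 2)))) =
      (∑' n : ℕ, α (n + 1)) + (∑' n : ℤ, β n) + Bj by
    rw [h_eq, sub_zero, zero_add, mul_zero, sub_zero, ← mul_assoc]
    congr 1
    field_simp]

end Limit

end QuasiInner

end Literature.NumberTheory.ConnesConsani2021

end
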